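import Literature.Analysis.FluidPDE.MildSolutionProofs
import Literature.Analysis.FluidPDE.MildSolutionHeatFlowProofs
import Literature.Analysis.FluidPDE.LerayHopfProofs
import Literature.Analysis.FluidPDE.WeakGradientIBP
import Literature.Analysis.FluidPDE.LerayHopfH1Test
import Literature.Analysis.FunctionSpaces.TimeMollification
import HarnessLib

/-!
# Leray–Hopf weak solutions are mild solutions (Fabes–Jones–Rivière 1972, Thm. 2.1): the proof

Analysis/FluidPDE support file. It serves the decomposition of Seregin's `L³` blow-up criterion
`Literature.Analysis.FluidPDE.seregin_L3_blowup` (`Literature/Analysis/FluidPDE/NSLerayHopf`, ns.S08), whose assembly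
(`NSLerayHopfSereginProofs`) uses the bridging fact `Literature.Analysis.FluidPDE.isMildNSSolutionOn_of_isLerayHopfOn`:
*a Leray–Hopf weak solution is a mild solution in the tested (duality) form on `(0, T]`*. That
fact is the `ℝ³` instance of the main theorem proved here.

**Main results** (all proved). Let `E` be a finite-dimensional real inner product space with
`dim E = 3`, `0 < ν`, `0 < T`, `u₀ ∈ L²(E; E)`, and `u` a Leray–Hopf weak solution of the unforced
Navier–Stokes system on `E × [0, T)` with datum `u₀` (accepted `Fluid.IsLerayHopfOn T ν 0 u₀ u`).

* `Fluid.IsLerayHopfOn.integral_inner_eq_mild`: for every smooth compactly supported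
  divergence-free `φ` and every `t ∈ (0, T]`,
  `⟨u(t), φ⟩ = ⟨u₀, e^{νtΔ}φ⟩ + ∫_{(0,t]} ⟨u(τ), (u(τ)·∇) e^{ν(t-τ)Δ}φ⟩ dτ`
  (Fabes–Jones–Rivière 1972, Thm. 2.1, (i) ⇒ (ii); Lemarié-Rieusset 2016, Prop. 6.5 with
  Thm. 6.1: Leray's weak solutions solve the integral equation);
* `Fluid.IsLerayHopfOn.isWeaklyDivFree_slice`: every slice `u(t)`, `0 < t ≤ T`, is weakly
  divergence free;
* `Fluid.IsLerayHopfOn.isMildNSSolutionOn_Ioc`: hence `u` is a mild solution on `(0, T]` with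
  datum `u₀` in the accepted duality form `Fluid.IsMildNSSolutionOn (Ioc 0 T) ν 0 u₀ u`
  (`Literature/Analysis/FluidPDE/MildSolution`). The slice `u 0` of the accepted Leray–Hopf
  predicate is unconstrained, whence `(0, T]`; at `t = 0` the duality identity is the weak
  initial condition (`Fluid.isMildNSSolutionFrom_zero_iff`).

## Proof

The printed proofs test the weak formulation with the caloric field `ψ(σ) = e^{ν(t-σ)Δ}φ`,
which solves the backward heat equation `∂_σψ = -νΔψ`, is divergence free, but is *not*
compactly supported in space, and let the viscous terms cancel. In the tree the accepted weak
formulation admits only compactly supported (divergence-free) space–time tests, while the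
accepted `H¹_σ` time-slice identity `Fluid.IsLerayHopfOn.inner_weakGrad_test_eq`
(`LerayHopfH1Test`) admits non-compactly supported *time-independent* tests `Ψ ∈ H¹_σ`:
`⟨u(s), Ψ⟩ = ⟨u₀, Ψ⟩ + ∫_{(0,s]} B(τ; ∇Ψ) dτ`, `B(τ; A) = ∫⟪A u(τ), u(τ)⟫ - ν Σᵢ ⟨∂ᵢu(τ), A eᵢ⟩`.
We therefore discretise the time dependence of the test (a Riemann-sum version of the printed
computation). For the uniform partition `s_k = kt/n` of `[0, t]`, telescoping gives
`⟨u(t), φ⟩ - ⟨u₀, ψ(0)⟩ = Σ_k [⟨u(s_{k+1}), ψ(s_k)⟩ - ⟨u(s_k), ψ(s_k)⟩] + [⟨u(s_{k+1}), ψ(s_{k+1}) - ψ(s_k)⟩]`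
(with `⟨u₀, ψ(0)⟩` in place of `⟨u(s_0), ψ(s_0)⟩`). The first brackets are
`∫_{s_k}^{s_{k+1}} B(τ; ∇ψ(s_k)) dτ` by the time-slice identity at the frozen test `ψ(s_k)`; the
second are `∫_{s_k}^{s_{k+1}} ⟨u(s_{k+1}), -νΔψ(σ)⟩ dσ` by the **caloric pairing lemma**
`integral_inner_heatTest_sub_eq` (the pointwise backward heat equation integrated against an `L²`
field, Fubini). As `n → ∞` the resulting integrand on `(0, t)` converges a.e. to
`B(τ; ∇ψ(τ)) + ⟨u(τ), -νΔψ(τ)⟩`: the flux error is controlled by the accepted bound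
`Fluid.enorm_weakFlux_sub_le` and the `L²`-Lipschitz continuity of `σ ↦ ∇ψ(σ)`
(`lintegral_frobeniusNormSq_fderiv_heatTest_sub_le`, again from the pairing lemma, by pairing
the increment with itself), the pairing term by the weak `L²`-continuity of `u`; everything is
dominated by `C(‖u(τ)‖₄² + ν‖∇u(τ)‖₂) + C'`, integrable by the accepted
`Fluid.IsLerayHopfOn.lintegral_weight_lt_top` — dominated convergence. Finally
`⟨u(τ), Δψ(τ)⟩ = -Σᵢ ⟨∂ᵢu(τ), ∂ᵢψ(τ)⟩` for a.e. `τ` (weak-gradient integration by parts against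
smooth `L²` fields, `HasWeakGradient.integral_inner_laplacian_of_memLp`, a cut-off extension of the
accepted compactly supported identity), so the viscous terms cancel and
`B + ⟨u, -νΔψ⟩ = ∫⟪u, (u·∇)ψ⟫`.

## Contents

* `L^p` bounds of the heat flow for all real times; the pointwise integrated backward heat
  equation `heatTest_sub_eq_integral`; the caloric pairing lemma and its bound
  (`integral_inner_heatTest_sub_eq`, `enorm_integral_inner_heatTest_sub_le`);
* weak-gradient integration by parts against smooth `L²` fields
  (`HasWeakGradient.integral_inner_fderiv_apply_of_memLp`, `.integral_inner_laplacian_of_memLp`);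
* the caloric extension of a test field: derivatives and Laplacian fall on the data, `L²`
  membership, weak divergence-freeness, weak gradient, Frobenius bounds
  (`fderiv_heatTest_apply`, `laplacian_heatTest`, `isWeaklyDivFree_heatTest`, …);
* `L²`-Lipschitz continuity in time of the caloric field and of its gradient
  (`eLpNorm_heatTest_sub_le`, `lintegral_frobeniusNormSq_fderiv_heatTest_sub_le`);
* uniform partitions (`exists_mem_Ioc_partition`, `sum_indicator_partition_eq`);
* the three main results.

## Mathlib search

Mathlib (this pin) has no heat semigroup on functions and no Navier–Stokes weak/mild solution
theory (cf. the module docstrings of `MildSolution` and `LerayHopfH1Test`); used from Mathlib: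
`intervalIntegral.integral_eq_sub_of_hasDerivAt_of_le` (FTC), `integral_integral_swap`,
`lintegral_prod_symm` (Fubini–Tonelli), `tendsto_integral_of_dominated_convergence`,
`Finset.sum_range_sub`, `Nat.ceil`. Everything fluid-specific is the tree's (see imports).

## References

* E. B. Fabes, B. F. Jones, N. M. Rivière, *The initial value problem for the Navier–Stokes
  equations with data in `L^p`*, Arch. Rational Mech. Anal. 45 (1972), 222–240, Thm. 2.1 and §2
  (`FabesJonesRiviere1972`).
* P. G. Lemarié-Rieusset, *The Navier–Stokes problem in the 21st century*, CRC Press (2016),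
  doi:10.1201/b19556, Prop. 6.5, Thm. 6.1, Def. 6.9 and §6.2 (PDF pp. 134–136)
  (`LemarieRieusset2016`).
* G. P. Galdi, *An introduction to the Navier–Stokes initial–boundary value problem*, in:
  Fundamental Directions in Mathematical Fluid Mechanics, Birkhäuser (2000), Lemma 2.1,
  Lemma 2.2, Def. 2.1 (`Galdi2000`).
* J. Serrin, *The initial value problem for the Navier–Stokes equations*, in: Nonlinear Problems
  (Madison 1962), Univ. Wisconsin Press (1963), §3 (`Serrin1963`).
-/

noncomputable section

open MeasureTheory TopologicalSpace Set Function Filter Topology InnerProductSpace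
open scoped RealInnerProductSpace ENNReal NNReal Laplacian ContDiff

namespace Literature.Analysis.FluidPDE

variable {E : Type*} [NormedAddCommGroup E] [InnerProductSpace ℝ E] [FiniteDimensional ℝ E]
  [MeasurableSpace E] [BorelSpace E]

/-! ### The caloric test field: `L^p` bounds for all times and the pairing lemma -/

section Caloric

variable {F' : Type*} [NormedAddCommGroup F'] [InnerProductSpace ℝ F'] [CompleteSpace F']

omit [MeasurableSpace E] [BorelSpace E] [CompleteSpace F'] in
/-- The Laplacian of a compactly supported field is compactly supported. [folklore] -/
theorem hasCompactSupport_laplacian {φ : E → F'} (hc : HasCompactSupport φ) :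
    HasCompactSupport (Δ φ) :=
  hc.mono' fun x hx => by
    by_contra h
    exact hx (laplacian_eq_zero_of_notMem_tsupport h)

/-- `L^p` contraction of the heat flow for *every* real time (for `τ ≤ 0` the flow is the
identity). [folklore] -/
theorem eLpNorm_heatFlow_le_of_memLp {g : E → F'} {p : ℝ≥0∞} (hg : MemLp g p volume) (hp : 1 ≤ p)
    (τ : ℝ) : eLpNorm (heatFlow g τ) p volume ≤ eLpNorm g p volume := by
  rcases le_or_gt τ 0 with hτ | hτ
  · rw [heatFlow_of_nonpos g hτ]
  · exact eLpNorm_heatFlow_le_holds hg hp hτ.le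

/-- The heat flow of an `L^p` function is in `L^p` for *every* real time. [folklore] -/
theorem memLp_heatFlow_of_memLp {g : E → F'} {p : ℝ≥0∞} (hg : MemLp g p volume) (hp : 1 ≤ p)
    (τ : ℝ) : MemLp (heatFlow g τ) p volume := by
  rcases le_or_gt τ 0 with hτ | hτ
  · rwa [heatFlow_of_nonpos g hτ]
  · exact memLp_heatFlow_holds hg hp hτ.le

/-- **Pointwise backward heat equation in integrated form.** For `φ ∈ C²_c`, `0 < ν` and
`σ₁ ≤ σ₂ ≤ t`,
`e^{ν(t-σ₂)Δ}φ(x) - e^{ν(t-σ₁)Δ}φ(x) = ∫_{σ₁}^{σ₂} -ν (e^{ν(t-σ)Δ}Δφ)(x) dσ`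
(fundamental theorem of calculus along `σ ↦ e^{ν(t-σ)Δ}φ(x)`, which is continuous on `[σ₁, σ₂]`
and solves `∂_σψ = -νΔψ` for `σ < t`; Fabes–Jones–Rivière 1972, §2). [cite: FabesJonesRiviere1972, §2] -/
theorem heatTest_sub_eq_integral {φ : E → F'} (hφ : ContDiff ℝ 2 φ) (hc : HasCompactSupport φ)
    {ν t σ₁ σ₂ : ℝ} (hν : 0 < ν) (h12 : σ₁ ≤ σ₂) (h2t : σ₂ ≤ t) (x : E) :
    heatTest ν φ (t - σ₂) x - heatTest ν φ (t - σ₁) x =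
      ∫ σ in σ₁..σ₂, -(ν • heatFlow (Δ φ) (ν * (t - σ)) x) := by
  obtain ⟨C, hC⟩ := hφ.continuous.bounded_above_of_compact_support hc
  have hΔc : Continuous (Δ φ) := continuous_laplacian hφ
  obtain ⟨C', hC'⟩ := hΔc.bounded_above_of_compact_support (hasCompactSupport_laplacian hc)
  -- continuity of `σ ↦ ψ σ x` and of the derivative
  have hcont : Continuous fun σ : ℝ => heatTest ν φ (t - σ) x :=
    (continuous_uncurry_heatTest_sub hφ.continuous hC ν t).comp
      (continuous_id.prodMk continuous_const)
  have hcontD : Continuous fun σ : ℝ => -(ν • heatFlow (Δ φ) (ν * (t - σ)) x) := by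
    have h1 : Continuous fun σ : ℝ => heatFlow (Δ φ) (ν * (t - σ)) x :=
      (continuous_uncurry_heatFlow hΔc hC').comp
        ((continuous_const.mul (continuous_const.sub continuous_id)).prodMk continuous_const)
    exact (h1.const_smul ν).neg
  symm
  refine intervalIntegral.integral_eq_sub_of_hasDerivAt_of_le h12 hcont.continuousOn
    (fun σ hσ => ?_) (hcontD.intervalIntegrable _ _)
  exact hasDerivAt_heatTest_sub hφ hc hν (lt_of_lt_of_le hσ.2 h2t) x

/-- The `L²` pairing with the time derivative of the caloric test field is bounded:
`|∫ ⟪w, -ν e^{aΔ}Δφ⟫| ≤ ν ‖w‖₂ ‖Δφ‖₂` (Cauchy–Schwarz and the `L²` contraction). [folklore] -/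
theorem enorm_integral_inner_heatFlow_laplacian_le {φ w : E → F'} (hw : MemLp w 2 volume)
    (hφ : ContDiff ℝ 2 φ) (hc : HasCompactSupport φ) {ν : ℝ} (hν : 0 ≤ ν) (a : ℝ) :
    ‖∫ x, ⟪w x, -(ν • heatFlow (Δ φ) a x)⟫‖ₑ ≤
      ENNReal.ofReal ν * (eLpNorm w 2 volume * eLpNorm (Δ φ) 2 volume) := by
  have hΔ2 : MemLp (Δ φ) 2 volume :=
    (continuous_laplacian hφ).memLp_of_hasCompactSupport (hasCompactSupport_laplacian hc)
  have hH : MemLp (heatFlow (Δ φ) a) 2 volume := memLp_heatFlow_of_memLp hΔ2 one_le_two a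
  have h1 : (fun x => ⟪w x, -(ν • heatFlow (Δ φ) a x)⟫) =
      fun x => -ν * ⟪w x, heatFlow (Δ φ) a x⟫ := by
    ext x; rw [inner_neg_right, real_inner_smul_right]; ring
  rw [h1, integral_const_mul, enorm_mul]
  have h2 : ‖(-ν : ℝ)‖ₑ = ENNReal.ofReal ν := by
    rw [Real.enorm_eq_ofReal_abs, abs_neg, abs_of_nonneg hν]
  rw [h2]
  gcongr
  exact (FunctionSpaces.enorm_integral_inner_le_eLpNorm_mul hw.1 hH.1).trans
    (mul_le_mul' le_rfl (eLpNorm_heatFlow_le_of_memLp hΔ2 one_le_two a))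

/-- The time derivative of the caloric test field, `-ν e^{ν(t-σ)Δ}Δφ`, has `L²` norm at most
`ν ‖Δφ‖₂`, for every `σ`. [folklore] -/
theorem eLpNorm_heatTestDeriv_le {φ : E → F'} (hφ : ContDiff ℝ 2 φ) (hc : HasCompactSupport φ)
    {ν : ℝ} (hν : 0 ≤ ν) (t σ : ℝ) :
    eLpNorm (fun x => -(ν • heatFlow (Δ φ) (ν * (t - σ)) x)) 2 volume ≤
      ENNReal.ofReal ν * eLpNorm (Δ φ) 2 volume := by
  have hΔ2 : MemLp (Δ φ) 2 volume :=
    (continuous_laplacian hφ).memLp_of_hasCompactSupport (hasCompactSupport_laplacian hc)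
  have h1 : (fun x => -(ν • heatFlow (Δ φ) (ν * (t - σ)) x)) = (-ν) • heatFlow (Δ φ) (ν * (t - σ)) := by
    ext x; simp [neg_smul]
  rw [h1, eLpNorm_const_smul, Real.enorm_eq_ofReal_abs, abs_neg, abs_of_nonneg hν]
  gcongr
  exact eLpNorm_heatFlow_le_of_memLp hΔ2 one_le_two _

/-- Joint continuity of the time derivative of the caloric test field. [folklore] -/
theorem continuous_heatTestDeriv {φ : E → F'} (hφ : ContDiff ℝ 2 φ) (hc : HasCompactSupport φ)
    (ν t : ℝ) : Continuous fun q : ℝ × E => -(ν • heatFlow (Δ φ) (ν * (t - q.1)) q.2) := by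
  have hΔc : Continuous (Δ φ) := continuous_laplacian hφ
  obtain ⟨C', hC'⟩ := hΔc.bounded_above_of_compact_support (hasCompactSupport_laplacian hc)
  have h1 : Continuous fun q : ℝ × E => heatFlow (Δ φ) (ν * (t - q.1)) q.2 :=
    (continuous_uncurry_heatFlow hΔc hC').comp
      ((continuous_const.mul (continuous_const.sub continuous_fst)).prodMk continuous_snd)
  exact (h1.const_smul ν).neg

/-- **The caloric pairing lemma.** For `w ∈ L²`, `φ ∈ C²_c`, `0 < ν` and `σ₁ ≤ σ₂ ≤ t`,
`⟨w, e^{ν(t-σ₂)Δ}φ⟩ - ⟨w, e^{ν(t-σ₁)Δ}φ⟩ = ∫_{σ₁}^{σ₂} ⟨w, -ν e^{ν(t-σ)Δ}Δφ⟩ dσ`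
(the pointwise identity `heatTest_sub_eq_integral` integrated against `w`, Fubini being justified
by `∫∫ |w| |e^{ν(t-σ)Δ}Δφ| ≤ (σ₂ - σ₁) ‖w‖₂ ν‖Δφ‖₂`; Fabes–Jones–Rivière 1972, §2, the duality
computation with the caloric test field). [cite: FabesJonesRiviere1972, §2] -/
theorem integral_inner_heatTest_sub_eq {φ w : E → F'} (hw : MemLp w 2 volume)
    (hφ : ContDiff ℝ 2 φ) (hc : HasCompactSupport φ) {ν t σ₁ σ₂ : ℝ} (hν : 0 < ν)
    (h12 : σ₁ ≤ σ₂) (h2t : σ₂ ≤ t) :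
    (∫ x, ⟪w x, heatTest ν φ (t - σ₂) x⟫) - ∫ x, ⟪w x, heatTest ν φ (t - σ₁) x⟫ =
      ∫ σ in σ₁..σ₂, ∫ x, ⟪w x, -(ν • heatFlow (Δ φ) (ν * (t - σ)) x)⟫ := by
  set D : ℝ → E → F' := fun σ x => -(ν • heatFlow (Δ φ) (ν * (t - σ)) x) with hD
  have hφ2 : MemLp φ 2 volume := hφ.continuous.memLp_of_hasCompactSupport hc
  have hΔ2 : MemLp (Δ φ) 2 volume :=
    (continuous_laplacian hφ).memLp_of_hasCompactSupport (hasCompactSupport_laplacian hc)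
  have hψ2 : ∀ σ, MemLp (heatTest ν φ (t - σ)) 2 volume := fun σ =>
    memLp_heatFlow_of_memLp hφ2 one_le_two _
  have hi : ∀ σ, Integrable (fun x => ⟪w x, heatTest ν φ (t - σ) x⟫) volume := fun σ =>
    integrable_inner_of_memLp_two hw (hψ2 σ)
  -- pointwise identity
  have hpt : ∀ x, heatTest ν φ (t - σ₂) x - heatTest ν φ (t - σ₁) x =
      ∫ σ in Ioc σ₁ σ₂, D σ x := fun x => by
    rw [hD, ← intervalIntegral.integral_of_le h12]
    exact heatTest_sub_eq_integral hφ hc hν h12 h2t x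
  -- the integrand on the product `E × (σ₁, σ₂]`
  have hDc : Continuous fun q : ℝ × E => D q.1 q.2 := continuous_heatTestDeriv hφ hc ν t
  set μ : Measure ℝ := volume.restrict (Ioc σ₁ σ₂) with hμ
  haveI : IsFiniteMeasure μ := by rw [hμ]; infer_instance
  have hm : AEStronglyMeasurable (fun z : E × ℝ => ⟪w z.1, D z.2 z.1⟫) (volume.prod μ) := by
    refine AEStronglyMeasurable.inner (𝕜 := ℝ) hw.1.comp_fst ?_
    exact (hDc.comp (continuous_snd.prodMk continuous_fst)).aestronglyMeasurable
  have hbound : ∀ σ, ∫⁻ x, ‖⟪w x, D σ x⟫‖ₑ ≤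
      eLpNorm w 2 volume * (ENNReal.ofReal ν * eLpNorm (Δ φ) 2 volume) := fun σ => by
    refine (FunctionSpaces.lintegral_enorm_inner_le_eLpNorm_mul hw.1 (hDc.comp
      (continuous_const.prodMk continuous_id)).aestronglyMeasurable).trans ?_
    exact mul_le_mul' le_rfl (eLpNorm_heatTestDeriv_le hφ hc hν.le t σ)
  have hint : Integrable (fun z : E × ℝ => ⟪w z.1, D z.2 z.1⟫) (volume.prod μ) := by
    refine ⟨hm, ?_⟩
    unfold HasFiniteIntegral
    rw [lintegral_prod_symm _ hm.enorm]
    calc ∫⁻ σ, ∫⁻ x, ‖⟪w x, D σ x⟫‖ₑ ∂volume ∂μ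
        ≤ ∫⁻ _σ, eLpNorm w 2 volume * (ENNReal.ofReal ν * eLpNorm (Δ φ) 2 volume) ∂μ :=
          lintegral_mono fun σ => hbound σ
      _ = eLpNorm w 2 volume * (ENNReal.ofReal ν * eLpNorm (Δ φ) 2 volume) * μ univ := by
          rw [lintegral_const]
      _ < ⊤ := by
          refine ENNReal.mul_lt_top (ENNReal.mul_lt_top hw.eLpNorm_lt_top
            (ENNReal.mul_lt_top ENNReal.ofReal_lt_top hΔ2.eLpNorm_lt_top)) ?_
          exact measure_lt_top _ _
  -- integrability in `σ` for a.e. (in fact every) `x`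
  have hDi : ∀ x, Integrable (fun σ => D σ x) μ := fun x =>
    ((hDc.comp (continuous_id.prodMk continuous_const)).integrableOn_Icc.mono_set
      Ioc_subset_Icc_self)
  calc (∫ x, ⟪w x, heatTest ν φ (t - σ₂) x⟫) - ∫ x, ⟪w x, heatTest ν φ (t - σ₁) x⟫
      = ∫ x, ⟪w x, heatTest ν φ (t - σ₂) x - heatTest ν φ (t - σ₁) x⟫ := by
        rw [← integral_sub (hi σ₂) (hi σ₁)]
        congr 1; ext x; rw [inner_sub_right]
    _ = ∫ x, ∫ σ, ⟪w x, D σ x⟫ ∂μ := by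
        congr 1; ext x
        rw [hpt x, ← integral_inner (hDi x) (w x)]
    _ = ∫ σ, (∫ x, ⟪w x, D σ x⟫) ∂μ := integral_integral_swap hint
    _ = ∫ σ in σ₁..σ₂, ∫ x, ⟪w x, D σ x⟫ := by
        rw [hμ, intervalIntegral.integral_of_le h12]

/-- **Bound for the caloric pairing increment**:
`|⟨w, e^{ν(t-σ₂)Δ}φ⟩ - ⟨w, e^{ν(t-σ₁)Δ}φ⟩| ≤ (σ₂ - σ₁) ν ‖w‖₂ ‖Δφ‖₂`. [folklore] -/
theorem enorm_integral_inner_heatTest_sub_le {φ w : E → F'} (hw : MemLp w 2 volume)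
    (hφ : ContDiff ℝ 2 φ) (hc : HasCompactSupport φ) {ν t σ₁ σ₂ : ℝ} (hν : 0 < ν)
    (h12 : σ₁ ≤ σ₂) (h2t : σ₂ ≤ t) :
    ‖(∫ x, ⟪w x, heatTest ν φ (t - σ₂) x⟫) - ∫ x, ⟪w x, heatTest ν φ (t - σ₁) x⟫‖ₑ ≤
      ENNReal.ofReal (σ₂ - σ₁) *
        (ENNReal.ofReal ν * (eLpNorm w 2 volume * eLpNorm (Δ φ) 2 volume)) := by
  rw [integral_inner_heatTest_sub_eq hw hφ hc hν h12 h2t, intervalIntegral.integral_of_le h12]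
  calc ‖∫ σ in Ioc σ₁ σ₂, ∫ x, ⟪w x, -(ν • heatFlow (Δ φ) (ν * (t - σ)) x)⟫‖ₑ
      ≤ ∫⁻ σ in Ioc σ₁ σ₂, ‖∫ x, ⟪w x, -(ν • heatFlow (Δ φ) (ν * (t - σ)) x)⟫‖ₑ :=
        enorm_integral_le_lintegral_enorm _
    _ ≤ ∫⁻ _σ in Ioc σ₁ σ₂, ENNReal.ofReal ν * (eLpNorm w 2 volume * eLpNorm (Δ φ) 2 volume) :=
        lintegral_mono fun σ => enorm_integral_inner_heatFlow_laplacian_le hw hφ hc hν.le _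
    _ = ENNReal.ofReal (σ₂ - σ₁) *
        (ENNReal.ofReal ν * (eLpNorm w 2 volume * eLpNorm (Δ φ) 2 volume)) := by
        rw [lintegral_const, Measure.restrict_apply_univ, Real.volume_Ioc, mul_comm]

end Caloric

/-! ### Weak-gradient integration by parts against smooth `L²` (not compactly supported) fields -/

section IBP

variable {F' : Type*} [NormedAddCommGroup F'] [InnerProductSpace ℝ F'] [FiniteDimensional ℝ F']

/-- **Vector weak-gradient identity beyond compact support.** If `G` is a weak gradient of
`u ∈ L²(E; F')` with `G v ∈ L²`, and `W ∈ C^∞(E; F')` with `W, ∂ᵥW ∈ L²`, then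
`∫ ⟪u, ∂ᵥW⟫ = -∫ ⟪G v, W⟫`. Proof: apply the compactly supported identity
(`HasWeakGradient.integral_inner_fderiv_apply_test`) to `χ_R W` with the tree's cut-off
`χ_R = cutoff R` and let `R → ∞`: `∂ᵥ(χ_R W) = χ_R ∂ᵥW + (∂ᵥχ_R) W` with `|∂ᵥχ_R| ≤ C‖v‖/R`,
and all pairings are products of `L²` functions (dominated convergence). [folklore] -/
theorem HasWeakGradient.integral_inner_fderiv_apply_of_memLp {u : E → F'} {G : E → E →L[ℝ] F'}
    (hu : HasWeakGradient u G) (hu2 : MemLp u 2 volume) (v : E)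
    (hGv : MemLp (fun x => G x v) 2 volume) {W : E → F'} (hW : ContDiff ℝ ∞ W)
    (hW2 : MemLp W 2 volume) (hDW : MemLp (fun x => fderiv ℝ W x v) 2 volume) :
    ∫ x, ⟪u x, fderiv ℝ W x v⟫ = -∫ x, ⟪G x v, W x⟫ := by
  obtain ⟨C, hC0, hC⟩ := exists_norm_fderiv_cutoff_le (E := E)
  have hR : ∀ n : ℕ, (0 : ℝ) < n + 1 := fun n => by positivity
  set χ : ℕ → E → ℝ := fun n => cutoff ((n : ℝ) + 1) with hχ
  have hWd : Differentiable ℝ W := hW.differentiable (by simp)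
  have hχd : ∀ n, Differentiable ℝ (χ n) := fun n =>
    (contDiff_cutoff (n := 1) _).differentiable one_ne_zero
  have hχc : ∀ n, Continuous (χ n) := fun n => (hχd n).continuous
  have hχD : ∀ n, Continuous (fderiv ℝ (χ n)) := fun n =>
    (contDiff_cutoff (n := 1) _).continuous_fderiv one_ne_zero
  have hχ1 : ∀ n x, |χ n x| ≤ 1 := fun n x => abs_cutoff_le_one _ _
  have hχtest : ∀ n, FunctionSpaces.IsTestFunctionOn (⊤ : Opens E) (fun x => χ n x • W x) := fun n =>
    { contDiff := (contDiff_cutoff _).smul hW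
      hasCompactSupport := (hasCompactSupport_cutoff (hR n)).smul_right
      tsupport_subset := by simp }
  -- the compactly supported identity and its expansion
  have hid : ∀ n, ∫ x, ⟪u x, fderiv ℝ (fun y => χ n y • W y) x v⟫ =
      -∫ x, ⟪G x v, χ n x • W x⟫ := fun n => hu.integral_inner_fderiv_apply_test (hχtest n) v
  have hexp : ∀ n x, ⟪u x, fderiv ℝ (fun y => χ n y • W y) x v⟫ =
      χ n x * ⟪u x, fderiv ℝ W x v⟫ + fderiv ℝ (χ n) x v * ⟪u x, W x⟫ := by
    intro n x
    rw [fderiv_fun_smul (hχd n x) (hWd x)]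
    simp only [_root_.add_apply, _root_.FunLike.coe_smul, Pi.smul_apply,
      ContinuousLinearMap.smulRight_apply, inner_add_right, real_inner_smul_right]
  -- integrability of the three pairings
  have i1 : Integrable (fun x => ⟪u x, fderiv ℝ W x v⟫) volume := integrable_inner_of_memLp_two hu2 hDW
  have i2 : Integrable (fun x => ⟪u x, W x⟫) volume := integrable_inner_of_memLp_two hu2 hW2
  have i3 : Integrable (fun x => ⟪G x v, W x⟫) volume := integrable_inner_of_memLp_two hGv hW2
  have i1n : ∀ n, Integrable (fun x => χ n x * ⟪u x, fderiv ℝ W x v⟫) volume := fun n =>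
    i1.bdd_mul (hχc n).aestronglyMeasurable
      (Eventually.of_forall fun x => by simpa [Real.norm_eq_abs] using hχ1 n x)
  have i3n : ∀ n, Integrable (fun x => χ n x * ⟪G x v, W x⟫) volume := fun n =>
    i3.bdd_mul (hχc n).aestronglyMeasurable
      (Eventually.of_forall fun x => by simpa [Real.norm_eq_abs] using hχ1 n x)
  have hbound2 : ∀ n x, ‖fderiv ℝ (χ n) x v * ⟪u x, W x⟫‖ ≤
      C / ((n : ℝ) + 1) * ‖v‖ * ‖⟪u x, W x⟫‖ := by
    intro n x
    rw [norm_mul]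
    gcongr
    exact (ContinuousLinearMap.le_opNorm _ _).trans (by gcongr; exact hC _ (hR n) x)
  have i2n : ∀ n, Integrable (fun x => fderiv ℝ (χ n) x v * ⟪u x, W x⟫) volume := by
    intro n
    refine (i2.norm.const_mul (C / ((n : ℝ) + 1) * ‖v‖)).mono' ?_
      (Eventually.of_forall (hbound2 n))
    exact (((hχD n).clm_apply continuous_const).aestronglyMeasurable).mul i2.1
  -- the identity at stage `n`
  have hstage : ∀ n, (∫ x, χ n x * ⟪u x, fderiv ℝ W x v⟫) +
      ∫ x, fderiv ℝ (χ n) x v * ⟪u x, W x⟫ = -∫ x, χ n x * ⟪G x v, W x⟫ := by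
    intro n
    have h := hid n
    simp_rw [hexp n] at h
    rw [integral_add (i1n n) (i2n n)] at h
    rw [h]
    congr 1
    refine integral_congr_ae (ae_of_all _ fun x => ?_)
    show ⟪G x v, χ n x • W x⟫ = χ n x * ⟪G x v, W x⟫
    rw [real_inner_smul_right]
  -- limits
  have hlim1 : Tendsto (fun n => ∫ x, χ n x * ⟪u x, fderiv ℝ W x v⟫) atTop
      (𝓝 (∫ x, ⟪u x, fderiv ℝ W x v⟫)) := by
    have := tendsto_integral_of_dominated_convergence (fun x => ‖⟪u x, fderiv ℝ W x v⟫‖)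
      (fun n => (i1n n).aestronglyMeasurable) i1.norm
      (fun n => Eventually.of_forall fun x => by
        rw [norm_mul]
        calc ‖χ n x‖ * ‖⟪u x, fderiv ℝ W x v⟫‖ ≤ 1 * ‖⟪u x, fderiv ℝ W x v⟫‖ := by
              gcongr; simpa [Real.norm_eq_abs] using hχ1 n x
          _ = _ := one_mul _)
      (Eventually.of_forall fun x => by
        simpa using (tendsto_cutoff_natCast_add_one x).mul_const ⟪u x, fderiv ℝ W x v⟫)
    simpa using this
  have hlim3 : Tendsto (fun n => ∫ x, χ n x * ⟪G x v, W x⟫) atTop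
      (𝓝 (∫ x, ⟪G x v, W x⟫)) := by
    have := tendsto_integral_of_dominated_convergence (fun x => ‖⟪G x v, W x⟫‖)
      (fun n => (i3n n).aestronglyMeasurable) i3.norm
      (fun n => Eventually.of_forall fun x => by
        rw [norm_mul]
        calc ‖χ n x‖ * ‖⟪G x v, W x⟫‖ ≤ 1 * ‖⟪G x v, W x⟫‖ := by
              gcongr; simpa [Real.norm_eq_abs] using hχ1 n x
          _ = _ := one_mul _)
      (Eventually.of_forall fun x => by
        simpa using (tendsto_cutoff_natCast_add_one x).mul_const ⟪G x v, W x⟫)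
    simpa using this
  have hlim2 : Tendsto (fun n => ∫ x, fderiv ℝ (χ n) x v * ⟪u x, W x⟫) atTop (𝓝 0) := by
    have hb : ∀ n, ‖∫ x, fderiv ℝ (χ n) x v * ⟪u x, W x⟫‖ ≤
        C / ((n : ℝ) + 1) * ‖v‖ * ∫ x, ‖⟪u x, W x⟫‖ := fun n => by
      calc ‖∫ x, fderiv ℝ (χ n) x v * ⟪u x, W x⟫‖ ≤ ∫ x, ‖fderiv ℝ (χ n) x v * ⟪u x, W x⟫‖ :=
            norm_integral_le_integral_norm _
        _ ≤ ∫ x, C / ((n : ℝ) + 1) * ‖v‖ * ‖⟪u x, W x⟫‖ :=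
            integral_mono_of_nonneg (Eventually.of_forall fun x => norm_nonneg _)
              (i2.norm.const_mul _) (Eventually.of_forall (hbound2 n))
        _ = C / ((n : ℝ) + 1) * ‖v‖ * ∫ x, ‖⟪u x, W x⟫‖ := integral_const_mul _ _
    have h0 : Tendsto (fun n : ℕ => C / ((n : ℝ) + 1) * ‖v‖ * ∫ x, ‖⟪u x, W x⟫‖) atTop (𝓝 0) := by
      have := ((tendsto_one_div_add_atTop_nhds_zero_nat.const_mul C).mul_const ‖v‖).mul_const
        (∫ x, ‖⟪u x, W x⟫‖)
      rw [mul_zero, zero_mul, zero_mul] at this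
      exact this.congr fun n => by ring
    exact squeeze_zero_norm hb h0
  have hL : Tendsto (fun n => (∫ x, χ n x * ⟪u x, fderiv ℝ W x v⟫) +
      ∫ x, fderiv ℝ (χ n) x v * ⟪u x, W x⟫) atTop (𝓝 ((∫ x, ⟪u x, fderiv ℝ W x v⟫) + 0)) :=
    hlim1.add hlim2
  rw [add_zero] at hL
  have hR' : Tendsto (fun n => (∫ x, χ n x * ⟪u x, fderiv ℝ W x v⟫) +
      ∫ x, fderiv ℝ (χ n) x v * ⟪u x, W x⟫) atTop (𝓝 (-∫ x, ⟪G x v, W x⟫)) := by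
    simp_rw [hstage]
    exact hlim3.neg
  exact tendsto_nhds_unique hL hR'

/-- **`∫ ⟪u, ΔΨ⟫ = -Σᵢ ∫ ⟪G eᵢ, ∂ᵢΨ⟫` beyond compact support.** For `u ∈ L²` with weak gradient
`G`, `G eᵢ ∈ L²`, and `Ψ ∈ C^∞(E; F')` with `∂ᵢΨ, ∂ᵢ∂ᵢΨ ∈ L²` for the standard frame `eᵢ`
(e.g. the caloric extension of a test field), the very weak (Leray) form `⟨u, ΔΨ⟩` equals the
`H¹` form `-⟨∇u, ∇Ψ⟩` (Serrin 1963, §3; Robinson–Rodrigo–Sadowski 2016, (3.3)–(3.4)): from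
`ΔΨ = Σᵢ ∂ᵢ(∂ᵢΨ)` and the vector identity applied to `W = ∂ᵢΨ`. [folklore] -/
theorem HasWeakGradient.integral_inner_laplacian_of_memLp {u : E → F'} {G : E → E →L[ℝ] F'}
    (hu : HasWeakGradient u G) (hu2 : MemLp u 2 volume)
    (hG2 : ∀ i, MemLp (fun x => G x (stdOrthonormalBasis ℝ E i)) 2 volume) {Ψ : E → F'}
    (hΨ : ContDiff ℝ ∞ Ψ)
    (hD : ∀ i, MemLp (fun x => fderiv ℝ Ψ x (stdOrthonormalBasis ℝ E i)) 2 volume)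
    (hDD : ∀ i, MemLp (fun x => fderiv ℝ (fun y => fderiv ℝ Ψ y (stdOrthonormalBasis ℝ E i)) x
      (stdOrthonormalBasis ℝ E i)) 2 volume) :
    ∫ x, ⟪u x, (Δ Ψ) x⟫ =
      -∑ i, ∫ x, ⟪G x (stdOrthonormalBasis ℝ E i),
        fderiv ℝ Ψ x (stdOrthonormalBasis ℝ E i)⟫ := by
  set b := stdOrthonormalBasis ℝ E with hb
  have hΨ2 : ContDiff ℝ 2 Ψ := contDiff_infty.1 hΨ 2
  have hW : ∀ i, ContDiff ℝ ∞ (fun y => fderiv ℝ Ψ y (b i)) := fun i =>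
    contDiff_infty.2 fun n => (hΨ.fderiv_right (m := n) (by exact_mod_cast le_top)).clm_apply
      contDiff_const
  have hpt : ∀ x, ⟪u x, (Δ Ψ) x⟫ =
      ∑ i, ⟪u x, fderiv ℝ (fun y => fderiv ℝ Ψ y (b i)) x (b i)⟫ := fun x => by
    rw [laplacian_eq_sum_fderiv_fderiv b hΨ2 x, inner_sum]
  have hi : ∀ i, Integrable
      (fun x => ⟪u x, fderiv ℝ (fun y => fderiv ℝ Ψ y (b i)) x (b i)⟫) volume := fun i =>
    integrable_inner_of_memLp_two hu2 (hDD i)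
  simp_rw [hpt]
  rw [integral_finsetSum _ (fun i _ => hi i), ← Finset.sum_neg_distrib]
  exact Finset.sum_congr rfl fun i _ =>
    hu.integral_inner_fderiv_apply_of_memLp hu2 (b i) (hG2 i) (hW i) (hD i) (hDD i)

end IBP

/-! ### The caloric extension of a test field: derivatives, `L²` bounds, `H¹_σ` data -/

section HeatTestField

variable {F' : Type*} [NormedAddCommGroup F'] [InnerProductSpace ℝ F'] [CompleteSpace F']

omit [CompleteSpace F'] in
/-- The caloric test field of smooth compactly supported data is smooth, for every time. [folklore] -/
theorem contDiff_heatTest {φ : E → F'} (hφ : FunctionSpaces.IsTestFunctionOn (⊤ : Opens E) φ) (ν τ : ℝ) :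
    ContDiff ℝ ∞ (heatTest ν φ τ) :=
  contDiff_heatFlow hφ.contDiff hφ.hasCompactSupport _

/-- The caloric test field of `L²` data is in `L²`, for every time. [folklore] -/
theorem memLp_heatTest {φ : E → F'} (hφ : FunctionSpaces.IsTestFunctionOn (⊤ : Opens E) φ) (ν τ : ℝ) :
    MemLp (heatTest ν φ τ) 2 volume :=
  memLp_heatFlow_of_memLp (hφ.memLp_volume 2) one_le_two _

/-- **Partial derivatives fall on the data**: `∂ᵢ(e^{ντΔ}φ) = e^{ντΔ}(∂ᵢφ)` for a test field `φ`
and every `τ` (the caloric extension commutes with derivatives and with evaluation of the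
derivative at a fixed vector; Lemarié-Rieusset 2016, §6.2). [folklore] -/
theorem fderiv_heatTest_apply {φ : E → F'} (hφ : FunctionSpaces.IsTestFunctionOn (⊤ : Opens E) φ) (ν τ : ℝ)
    (x v : E) :
    fderiv ℝ (heatTest ν φ τ) x v = heatTest ν (fun y => fderiv ℝ φ y v) τ x := by
  have hφ1 : ContDiff ℝ 1 φ := hφ.contDiff.of_le (by exact_mod_cast le_top)
  change fderiv ℝ (heatFlow φ (ν * τ)) x v = heatFlow (fun y => fderiv ℝ φ y v) (ν * τ) x
  rw [fderiv_heatFlow hφ1 hφ.hasCompactSupport]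
  rcases le_or_gt (ν * τ) 0 with h | h
  · rw [heatFlow_of_nonpos _ h, heatFlow_of_nonpos _ h]
  · rw [heatFlow_of_pos _ h, heatFlow_of_pos _ h]
    exact (UnboundedOperators.heatExtension_clm_comp (ContinuousLinearMap.apply ℝ F' v)
      (hφ1.continuous_fderiv one_ne_zero) (hφ.hasCompactSupport.fderiv ℝ) (ν * τ) x).symm

/-- **The Laplacian falls on the data**: `Δ(e^{ντΔ}φ) = e^{ντΔ}(Δφ)` for a test field and every
`τ` (Lemarié-Rieusset 2016, §6.2). [folklore] -/
theorem laplacian_heatTest {φ : E → F'} (hφ : FunctionSpaces.IsTestFunctionOn (⊤ : Opens E) φ) (ν τ : ℝ)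
    (x : E) : (Δ (heatTest ν φ τ)) x = heatTest ν (Δ φ) τ x :=
  laplacian_heatFlow (contDiff_infty.1 hφ.contDiff 2) hφ.hasCompactSupport _ x

/-- The partial derivatives of the caloric test field are in `L²`. [folklore] -/
theorem memLp_fderiv_heatTest_apply {φ : E → F'} (hφ : FunctionSpaces.IsTestFunctionOn (⊤ : Opens E) φ)
    (ν τ : ℝ) (v : E) : MemLp (fun x => fderiv ℝ (heatTest ν φ τ) x v) 2 volume := by
  have h : (fun x => fderiv ℝ (heatTest ν φ τ) x v) = heatTest ν (fun y => fderiv ℝ φ y v) τ :=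
    funext fun x => fderiv_heatTest_apply hφ ν τ x v
  rw [h]
  exact memLp_heatTest (hφ.fderiv_apply_const v) ν τ

/-- The pure second partial derivatives of the caloric test field are in `L²`. [folklore] -/
theorem memLp_fderiv_fderiv_heatTest_apply {φ : E → F'} (hφ : FunctionSpaces.IsTestFunctionOn (⊤ : Opens E) φ)
    (ν τ : ℝ) (v : E) :
    MemLp (fun x => fderiv ℝ (fun y => fderiv ℝ (heatTest ν φ τ) y v) x v) 2 volume := by
  have h : (fun y => fderiv ℝ (heatTest ν φ τ) y v) = heatTest ν (fun y => fderiv ℝ φ y v) τ :=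
    funext fun x => fderiv_heatTest_apply hφ ν τ x v
  rw [h]
  exact memLp_fderiv_heatTest_apply (hφ.fderiv_apply_const v) ν τ v

/-- The Laplacian of the caloric test field is in `L²`. [folklore] -/
theorem memLp_laplacian_heatTest {φ : E → F'} (hφ : FunctionSpaces.IsTestFunctionOn (⊤ : Opens E) φ) (ν τ : ℝ) :
    MemLp (Δ (heatTest ν φ τ)) 2 volume := by
  have h : Δ (heatTest ν φ τ) = heatTest ν (Δ φ) τ := funext fun x => laplacian_heatTest hφ ν τ x
  rw [h]
  exact memLp_heatFlow_of_memLp (hφ.memLp_laplacian 2) one_le_two _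

variable {φ : E → E}

/-- The caloric test field of a divergence-free test field is weakly divergence free, for every
time (Fabes–Jones–Rivière 1972, §2). [cite: FabesJonesRiviere1972, §2] -/
theorem isWeaklyDivFree_heatTest (hφ : FunctionSpaces.IsTestFunctionOn (⊤ : Opens E) φ) (hdiv : VectorCalculus.IsDivFree φ)
    (ν τ : ℝ) : IsWeaklyDivFree (heatTest ν φ τ) := by
  have hφ1 : ContDiff ℝ 1 φ := hφ.contDiff.of_le (by exact_mod_cast le_top)
  have h1 : ContDiff ℝ 1 (heatTest ν φ τ) := (contDiff_heatTest hφ ν τ).of_le (by exact_mod_cast le_top)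
  exact VectorCalculus.IsDivFree.isWeaklyDivFree_holds (isDivFree_heatFlow hφ1 hφ.hasCompactSupport hdiv _) h1

/-- The classical gradient of the caloric test field is a weak gradient. [folklore] -/
theorem hasWeakGradient_heatTest (hφ : FunctionSpaces.IsTestFunctionOn (⊤ : Opens E) φ) (ν τ : ℝ) :
    HasWeakGradient (heatTest ν φ τ) (fderiv ℝ (heatTest ν φ τ)) :=
  HasWeakGradient.of_contDiff_holds ((contDiff_heatTest hφ ν τ).of_le (by exact_mod_cast le_top))

/-- The gradient of the caloric test field has finite Frobenius `L²` mass. [folklore] -/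
theorem lintegral_frobeniusNormSq_fderiv_heatTest_lt_top (hφ : FunctionSpaces.IsTestFunctionOn (⊤ : Opens E) φ)
    (ν τ : ℝ) :
    ∫⁻ x, ENNReal.ofReal (frobeniusNormSq (fderiv ℝ (heatTest ν φ τ) x)) < ⊤ := by
  have hm : AEStronglyMeasurable (fderiv ℝ (heatTest ν φ τ)) volume :=
    ((contDiff_heatTest hφ ν τ).continuous_fderiv (by simp)).aestronglyMeasurable
  rw [lintegral_ofReal_frobeniusNormSq_eq_sum hm]
  refine ENNReal.sum_lt_top.2 fun i _ => ?_
  have h := (memLp_fderiv_heatTest_apply hφ ν τ (stdOrthonormalBasis ℝ E i)).eLpNorm_lt_top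
  rw [eLpNorm_eq_lintegral_rpow_enorm_toReal two_ne_zero ENNReal.ofNat_ne_top,
    ENNReal.toReal_ofNat] at h
  exact (ENNReal.rpow_lt_top_iff_of_pos (by norm_num : (0 : ℝ) < 1 / 2)).1 h

end HeatTestField

/-! ### `L²` continuity in time of the caloric test field and of its gradient -/

section TimeContinuity

variable {F' : Type*} [NormedAddCommGroup F'] [InnerProductSpace ℝ F'] [CompleteSpace F']

omit [CompleteSpace F'] in
/-- `‖∫ ⟪v, v⟫‖ₑ = ‖v‖₂²` for `v ∈ L²`. [folklore] -/
theorem enorm_integral_inner_self {v : E → F'} (hv : MemLp v 2 volume) :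
    ‖∫ x, ⟪v x, v x⟫‖ₑ = eLpNorm v 2 volume ^ 2 := by
  have hint : Integrable (fun x => ‖v x‖ ^ 2) volume := hv.integrable_norm_pow two_ne_zero
  have h1 : ∫ x, ⟪v x, v x⟫ = ∫ x, ‖v x‖ ^ 2 :=
    integral_congr_ae (ae_of_all _ fun x => real_inner_self_eq_norm_sq _)
  have hnn : 0 ≤ ∫ x, ‖v x‖ ^ 2 := integral_nonneg fun _ => sq_nonneg _
  rw [h1, Real.enorm_eq_ofReal hnn, ofReal_integral_eq_lintegral_ofReal hint
    (ae_of_all _ fun _ => sq_nonneg _), eLpNorm_two_sq_eq_lintegral]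
  exact lintegral_congr fun x => by rw [← ofReal_norm, ENNReal.ofReal_pow (norm_nonneg _)]

/-- **`L²`-Lipschitz continuity in time of the caloric test field**: for `φ ∈ C²_c`, `0 < ν`,
`σ₁ ≤ σ₂ ≤ t`, `‖e^{ν(t-σ₂)Δ}φ - e^{ν(t-σ₁)Δ}φ‖₂ ≤ (σ₂ - σ₁) ν ‖Δφ‖₂` (pair the difference
`v` with itself: `‖v‖₂² = ⟨v, ψ(σ₂)⟩ - ⟨v, ψ(σ₁)⟩ ≤ (σ₂ - σ₁) ν ‖v‖₂ ‖Δφ‖₂` by the caloric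
pairing lemma). [folklore] -/
theorem eLpNorm_heatTest_sub_le {φ : E → F'} (hφ : ContDiff ℝ 2 φ) (hc : HasCompactSupport φ)
    {ν t σ₁ σ₂ : ℝ} (hν : 0 < ν) (h12 : σ₁ ≤ σ₂) (h2t : σ₂ ≤ t) :
    eLpNorm (heatTest ν φ (t - σ₂) - heatTest ν φ (t - σ₁)) 2 volume ≤
      ENNReal.ofReal (σ₂ - σ₁) * (ENNReal.ofReal ν * eLpNorm (Δ φ) 2 volume) := by
  have hφ2 : MemLp φ 2 volume := hφ.continuous.memLp_of_hasCompactSupport hc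
  have hψ : ∀ σ, MemLp (heatTest ν φ (t - σ)) 2 volume := fun σ =>
    memLp_heatFlow_of_memLp hφ2 one_le_two _
  set v : E → F' := heatTest ν φ (t - σ₂) - heatTest ν φ (t - σ₁) with hvdef
  have hv : MemLp v 2 volume := (hψ σ₂).sub (hψ σ₁)
  have key := enorm_integral_inner_heatTest_sub_le hv hφ hc hν h12 h2t
  have heq : (∫ x, ⟪v x, heatTest ν φ (t - σ₂) x⟫) - ∫ x, ⟪v x, heatTest ν φ (t - σ₁) x⟫ =
      ∫ x, ⟪v x, v x⟫ := by
    rw [← integral_sub (integrable_inner_of_memLp_two hv (hψ σ₂))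
      (integrable_inner_of_memLp_two hv (hψ σ₁))]
    refine integral_congr_ae (ae_of_all _ fun x => ?_)
    simp only [hvdef, Pi.sub_apply, inner_sub_right, inner_sub_left]
  rw [heq, enorm_integral_inner_self hv, sq] at key
  set a := eLpNorm v 2 volume with ha
  set K := ENNReal.ofReal (σ₂ - σ₁) * (ENNReal.ofReal ν * eLpNorm (Δ φ) 2 volume) with hK
  have key' : a * a ≤ K * a := by
    calc a * a ≤ ENNReal.ofReal (σ₂ - σ₁) * (ENNReal.ofReal ν * (a * eLpNorm (Δ φ) 2 volume)) := key
      _ = K * a := by rw [hK]; ring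
  by_cases h0 : a = 0
  · simp [h0]
  · exact (ENNReal.mul_le_mul_iff_left h0 hv.eLpNorm_ne_top).1 key'

/-- **`L²`-Lipschitz continuity in time of the gradient of the caloric test field**, Frobenius
form: for a test field `φ`, `0 < ν`, `σ₁ ≤ σ₂ ≤ t`,
`∫ |∇e^{ν(t-σ₂)Δ}φ - ∇e^{ν(t-σ₁)Δ}φ|² ≤ (σ₂ - σ₁)² Σᵢ (ν ‖Δ∂ᵢφ‖₂)²` (the previous bound applied
to the data `∂ᵢφ`, since `∂ᵢ e^{ντΔ}φ = e^{ντΔ}∂ᵢφ`). [folklore] -/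
theorem lintegral_frobeniusNormSq_fderiv_heatTest_sub_le {φ : E → F'}
    (hφ : FunctionSpaces.IsTestFunctionOn (⊤ : Opens E) φ) {ν t σ₁ σ₂ : ℝ} (hν : 0 < ν) (h12 : σ₁ ≤ σ₂)
    (h2t : σ₂ ≤ t) :
    ∫⁻ x, ENNReal.ofReal (frobeniusNormSq
        (fderiv ℝ (heatTest ν φ (t - σ₂)) x - fderiv ℝ (heatTest ν φ (t - σ₁)) x)) ≤
      ENNReal.ofReal (σ₂ - σ₁) ^ 2 * ∑ i, (ENNReal.ofReal ν *
        eLpNorm (Δ (fun y => fderiv ℝ φ y (stdOrthonormalBasis ℝ E i))) 2 volume) ^ 2 := by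
  set b := stdOrthonormalBasis ℝ E with hb
  have hm : ∀ σ, AEStronglyMeasurable (fderiv ℝ (heatTest ν φ (t - σ))) volume := fun σ =>
    ((contDiff_heatTest hφ ν _).continuous_fderiv (by simp)).aestronglyMeasurable
  change ∫⁻ x, ENNReal.ofReal (frobeniusNormSq
    ((fderiv ℝ (heatTest ν φ (t - σ₂)) - fderiv ℝ (heatTest ν φ (t - σ₁))) x)) ≤ _
  rw [lintegral_ofReal_frobeniusNormSq_eq_sum ((hm σ₂).sub (hm σ₁)), Finset.mul_sum]
  refine Finset.sum_le_sum fun i _ => ?_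
  have hφi : FunctionSpaces.IsTestFunctionOn (⊤ : Opens E) (fun y => fderiv ℝ φ y (b i)) := hφ.fderiv_apply_const (b i)
  have heq : (fun x => (fderiv ℝ (heatTest ν φ (t - σ₂)) - fderiv ℝ (heatTest ν φ (t - σ₁))) x (b i)) =
      heatTest ν (fun y => fderiv ℝ φ y (b i)) (t - σ₂) -
        heatTest ν (fun y => fderiv ℝ φ y (b i)) (t - σ₁) := by
    ext x
    rw [Pi.sub_apply, _root_.sub_apply, Pi.sub_apply, fderiv_heatTest_apply hφ,
      fderiv_heatTest_apply hφ]
  have h2 : ∫⁻ x, ‖(fderiv ℝ (heatTest ν φ (t - σ₂)) - fderiv ℝ (heatTest ν φ (t - σ₁))) x (b i)‖ₑ ^ (2 : ℝ) =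
      eLpNorm (heatTest ν (fun y => fderiv ℝ φ y (b i)) (t - σ₂) -
        heatTest ν (fun y => fderiv ℝ φ y (b i)) (t - σ₁)) 2 volume ^ 2 := by
    rw [eLpNorm_two_sq_eq_lintegral, ← heq]
    exact lintegral_congr fun x => by rw [← ENNReal.rpow_two]
  rw [h2, ← mul_pow]
  gcongr
  exact eLpNorm_heatTest_sub_le (contDiff_infty.1 hφi.contDiff 2) hφi.hasCompactSupport hν h12 h2t

end TimeContinuity

/-! ### Uniform partitions of `[0, t]` -/

section Partition

/-- **Locating a point in a uniform partition.** For `0 < t`, `0 < n` and `τ ∈ (0, t]` there is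
`k < n` with `τ ∈ (t k / n, t (k+1) / n]`. [folklore] -/
theorem exists_mem_Ioc_partition {t : ℝ} (ht : 0 < t) {n : ℕ} (hn : 0 < n) {τ : ℝ}
    (hτ : τ ∈ Ioc 0 t) :
    ∃ k : ℕ, k < n ∧ τ ∈ Ioc (t * k / n) (t * ((k + 1 : ℕ) : ℝ) / n) := by
  have hn' : (0 : ℝ) < n := Nat.cast_pos.2 hn
  set r : ℝ := τ * n / t with hr
  have hr0 : 0 < r := div_pos (mul_pos hτ.1 hn') ht
  set m : ℕ := ⌈r⌉₊ with hm
  have hm1 : 1 ≤ m := Nat.one_le_iff_ne_zero.2 (Nat.pos_iff_ne_zero.1 (Nat.ceil_pos.2 hr0))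
  refine ⟨m - 1, ?_, ?_, ?_⟩
  · have hmn : m ≤ n := by
      rw [hm]
      refine Nat.ceil_le.2 ?_
      rw [hr, div_le_iff₀ ht]
      nlinarith [hτ.2]
    omega
  · have hcast : ((m - 1 : ℕ) : ℝ) = (m : ℝ) - 1 := by
      rw [Nat.cast_sub hm1, Nat.cast_one]
    rw [hcast]
    have hlt : (m : ℝ) - 1 < r := by
      have := Nat.ceil_lt_add_one hr0.le
      rw [← hm] at this; linarith
    have : t * ((m : ℝ) - 1) / n < t * r / n := by
      exact div_lt_div_of_pos_right (mul_lt_mul_of_pos_left hlt ht) hn'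
    refine this.trans_le (le_of_eq ?_)
    rw [hr]; field_simp
  · have hcast : ((m - 1 + 1 : ℕ) : ℝ) = (m : ℝ) := by
      rw [Nat.sub_add_cancel hm1]
    rw [hcast]
    have hle : r ≤ m := Nat.le_ceil r
    have : t * r / n ≤ t * (m : ℝ) / n :=
      div_le_div_of_nonneg_right (mul_le_mul_of_nonneg_left hle ht.le) hn'.le
    refine le_trans (le_of_eq ?_) this
    rw [hr]; field_simp

/-- Two cells of a uniform partition containing a common point coincide. [folklore] -/
theorem partition_index_unique {t : ℝ} (ht : 0 < t) {n : ℕ} (hn : 0 < n) {τ : ℝ} {k j : ℕ}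
    (hk : τ ∈ Ioc (t * k / n) (t * ((k + 1 : ℕ) : ℝ) / n))
    (hj : τ ∈ Ioc (t * j / n) (t * ((j + 1 : ℕ) : ℝ) / n)) :
    k = j := by
  have hn' : (0 : ℝ) < n := Nat.cast_pos.2 hn
  have h1 : (k : ℝ) < j + 1 := by
    have := hk.1.trans_le hj.2
    rw [div_lt_div_iff_of_pos_right hn'] at this
    push_cast at this
    nlinarith
  have h2 : (j : ℝ) < k + 1 := by
    have := hj.1.trans_le hk.2
    rw [div_lt_div_iff_of_pos_right hn'] at this
    push_cast at this
    nlinarith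
  have h1' : k < j + 1 := by exact_mod_cast h1
  have h2' : j < k + 1 := by exact_mod_cast h2
  omega

/-- **Evaluation of a partition-wise defined function**: on the cell `(t k / n, t (k+1) / n]` the
sum of the indicator-truncated cell functions is the `k`-th cell function. [folklore] -/
theorem sum_indicator_partition_eq {t : ℝ} (ht : 0 < t) {n : ℕ} (hn : 0 < n) (H : ℕ → ℝ → ℝ)
    {τ : ℝ} {k : ℕ} (hk : k < n) (hτ : τ ∈ Ioc (t * k / n) (t * ((k + 1 : ℕ) : ℝ) / n)) :
    ∑ j ∈ Finset.range n, (Ioc (t * j / n) (t * ((j + 1 : ℕ) : ℝ) / n)).indicator (H j) τ =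
      H k τ := by
  rw [Finset.sum_eq_single_of_mem k (Finset.mem_range.2 hk)]
  · exact indicator_of_mem hτ _
  · intro j _ hjk
    refine indicator_of_notMem (fun hj => hjk ?_) _
    exact (partition_index_unique ht hn hτ hj).symm

end Partition

/-! ### Leray–Hopf solutions are mild solutions -/

section Main

variable {T ν : ℝ} {u₀ : E → E} {u : ℝ → E → E}

omit [MeasurableSpace E] [BorelSpace E] in
/-- `|A - B|² = |B - A|²` for the Frobenius norm. [folklore] -/
theorem frobeniusNormSq_sub_comm (A B : E →L[ℝ] E) :
    frobeniusNormSq (A - B) = frobeniusNormSq (B - A) := by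
  simp only [frobeniusNormSq, _root_.sub_apply, norm_sub_rev]

/-- Real bounds from `ℝ≥0∞` bounds. [folklore] -/
theorem norm_le_toReal_of_enorm_le {x : ℝ} {K : ℝ≥0∞} (hK : K ≠ ⊤) (h : ‖x‖ₑ ≤ K) :
    ‖x‖ ≤ K.toReal := by
  rw [← toReal_enorm]; exact ENNReal.toReal_mono hK h

/-- **Leray–Hopf weak solutions satisfy the duality (mild) identity** (Fabes–Jones–Rivière 1972,
Thm. 2.1, (i) ⇒ (ii); Lemarié-Rieusset 2016, Prop. 6.5 with Thm. 6.1). Let `dim E = 3`, `0 < ν`,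
`u₀ ∈ L²`, `u` a Leray–Hopf weak solution of the unforced Navier–Stokes system on `E × [0, T)`
with datum `u₀`, `φ` a smooth compactly supported divergence-free field and `t ∈ (0, T]`. Then
`⟨u(t), φ⟩ = ⟨u₀, e^{νtΔ}φ⟩ + ∫_{(0,t]} ⟨u, (u·∇) e^{ν(t-τ)Δ}φ⟩ dτ`.

Proof (a Riemann-sum form of testing the weak formulation with the caloric field
`ψ(σ) = e^{ν(t-σ)Δ}φ`): for the uniform partition `s_k = kt/n` of `[0, t]`, telescope
`⟨u(t), φ⟩ - ⟨u₀, ψ(0)⟩ = Σ_k (⟨u(s_{k+1}), ψ(s_k)⟩ - ⟨u(s_k), ψ(s_k)⟩) + (⟨u(s_{k+1}), ψ(s_{k+1}) - ψ(s_k)⟩)`;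
the first differences are `∫_{s_k}^{s_{k+1}} B(τ; ∇ψ(s_k)) dτ` by the `H¹_σ` time-slice identity
(`IsLerayHopfOn.inner_weakGrad_test_eq`, `B(τ; A) = ∫⟪A u, u⟫ - ν Σᵢ ⟨∂ᵢu, A eᵢ⟩`), the second
ones `∫_{s_k}^{s_{k+1}} ⟨u(s_{k+1}), -νΔψ(σ)⟩ dσ` by the caloric pairing lemma. As `n → ∞` the
resulting integrand converges a.e. to `B(τ; ∇ψ(τ)) + ⟨u(τ), -νΔψ(τ)⟩` (`L²`-Lipschitz continuity
of `σ ↦ ∇ψ(σ)` with the flux error bound `enorm_weakFlux_sub_le`, and weak `L²`-continuity of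
`u`), dominated by `C (‖u(τ)‖₄² + ν‖∇u(τ)‖₂) + C'` — dominated convergence; finally
`ν⟨u, Δψ⟩ = -ν⟨∇u, ∇ψ⟩` a.e. (`HasWeakGradient.integral_inner_laplacian_of_memLp`), so the viscous
terms cancel and `B + ⟨u, -νΔψ⟩ = ⟨u, (u·∇)ψ⟩`. [cite: FabesJonesRiviere1972, Thm. 2.1] -/
theorem IsLerayHopfOn.integral_inner_eq_mild (hE3 : Module.finrank ℝ E = 3)
    (hu : IsLerayHopfOn T ν 0 u₀ u) (hu₀ : MemLp u₀ 2 volume) (hν : 0 < ν) (hT : 0 < T)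
    {φ : E → E} (hφ : FunctionSpaces.IsTestFunctionOn (⊤ : Opens E) φ) (hdiv : VectorCalculus.IsDivFree φ) {t : ℝ}
    (ht : t ∈ Ioc 0 T) :
    ∫ x, ⟪u t x, φ x⟫ = (∫ x, ⟪u₀ x, heatTest ν φ t x⟫) +
      ∫ τ in Ioc 0 t, ∫ x, ⟪u τ x, convect (u τ) (heatTest ν φ (t - τ)) x⟫ := by
  set b := stdOrthonormalBasis ℝ E with hb
  have hb1 : ∀ i, ‖b i‖ = 1 := fun i => b.orthonormal.1 i
  have htT : t ≤ T := ht.2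
  have ht0 : 0 < t := ht.1
  -- ### a jointly measurable weak-gradient witness of finite dissipation
  obtain ⟨G, hG, hG₂, hEn, -⟩ := hu.weakGrad_energy
  obtain ⟨Gu, hGum, hGuae⟩ := exists_stronglyMeasurable_weakGradient hu.weak.1 hG
  have hGu : ∀ᵐ τ ∂(volume.restrict (Ioo 0 T)), HasWeakGradient (u τ) (Gu τ) := by
    filter_upwards [hG, hGuae] with τ h1 h2
    exact h1.congr_grad_ae h2
  have hDeq : ∀ᵐ τ ∂(volume.restrict (Ioo 0 T)),
      ∫⁻ x, ENNReal.ofReal (frobeniusNormSq (Gu τ x)) =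
        ∫⁻ x, ENNReal.ofReal (frobeniusNormSq (G τ x)) := by
    filter_upwards [hGuae] with τ hτ
    exact lintegral_congr_ae (by filter_upwards [hτ] with x hx; rw [hx])
  have hGu₂ : ∫⁻ τ in Ioo 0 T, ∫⁻ x, ENNReal.ofReal (frobeniusNormSq (Gu τ x)) < ⊤ := by
    rw [lintegral_congr_ae hDeq]; exact hG₂
  -- ### uniform `L²` bound of the slices
  have hEn' : ∀ s ∈ Icc 0 T, VectorCalculus.kineticEnergy (u s) +
      ν * (∫⁻ τ in Ioo 0 s, ∫⁻ x, ENNReal.ofReal (frobeniusNormSq (G τ x))).toReal ≤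
        VectorCalculus.kineticEnergy u₀ := fun s hs => by simpa using hEn s hs
  set M : ℝ≥0∞ := ENNReal.ofReal (2 * VectorCalculus.kineticEnergy u₀) ^ (1 / 2 : ℝ) with hMdef
  have hMtop : M ≠ ⊤ := ENNReal.rpow_ne_top_of_nonneg (by norm_num) ENNReal.ofReal_ne_top
  have hM : ∀ s ∈ Icc 0 T, eLpNorm (u s) 2 volume ≤ M := fun s hs => hu.eLpNorm_two_le hν.le hEn' hs
  have hL2 : ∀ s ∈ Icc 0 T, MemLp (u s) 2 volume := hu.memLp
  -- ### the caloric test field `ψ σ = e^{ν(t-σ)Δ}φ` and its gradient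
  set ψ : ℝ → E → E := fun σ => heatTest ν φ (t - σ) with hψ
  set Gψ : ℝ → E → E →L[ℝ] E := fun σ => fderiv ℝ (ψ σ) with hGψ
  have hψ2 : ∀ σ, MemLp (ψ σ) 2 volume := fun σ => memLp_heatTest hφ ν _
  have hψdiv : ∀ σ, IsWeaklyDivFree (ψ σ) := fun σ => isWeaklyDivFree_heatTest hφ hdiv ν _
  have hψG : ∀ σ, HasWeakGradient (ψ σ) (Gψ σ) := fun σ => hasWeakGradient_heatTest hφ ν _
  have hGψ2 : ∀ σ, ∫⁻ x, ENNReal.ofReal (frobeniusNormSq (Gψ σ x)) < ⊤ := fun σ =>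
    lintegral_frobeniusNormSq_fderiv_heatTest_lt_top hφ ν _
  have hGψm : ∀ σ, AEStronglyMeasurable (Gψ σ) volume := fun σ =>
    (hψG σ).aestronglyMeasurable_deriv
  -- ### the flux `B σ τ = B(τ; ∇ψ(σ))` and the `H¹_σ` time-slice identity
  set B : ℝ → ℝ → ℝ := fun σ τ => (∫ x, ⟪Gψ σ x (u τ x), u τ x⟫) -
    ν * ∑ i, ∫ x, ⟪Gu τ x (b i), Gψ σ x (b i)⟫ with hB
  have hstar : ∀ σ, ∀ s ∈ Ioc 0 T, ∫ x, ⟪u s x, ψ σ x⟫ =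
      (∫ x, ⟪u₀ x, ψ σ x⟫) + ∫ τ in Ioc 0 s, B σ τ := fun σ s hs =>
    hu.inner_weakGrad_test_eq hE3 hu₀ hT hGum hGu hGu₂ (hψ2 σ) (hψdiv σ) (hψG σ) (hGψ2 σ) hs
  have hBint : ∀ σ, IntegrableOn (B σ) (Ioc 0 T) := fun σ =>
    (integrableOn_Ioc_iff_integrableOn_Ioo (hb := enorm_ne_top)).2
      (hu.integrableOn_weakFlux hE3 hGum hGu hGu₂ (hGψm σ) (hGψ2 σ))
  -- ### the time derivative `Dψ σ = -νΔψ(σ)` and the pairing `g s σ = ⟨u s, Dψ σ⟩`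
  set Dψ : ℝ → E → E := fun σ x => -(ν • heatFlow (Δ φ) (ν * (t - σ)) x) with hDψ
  set g : ℝ → ℝ → ℝ := fun s σ => ∫ x, ⟪u s x, Dψ σ x⟫ with hg
  have hφ2 : ContDiff ℝ 2 φ := contDiff_infty.1 hφ.contDiff 2
  have hΔφ2 : MemLp (Δ φ) 2 volume := hφ.memLp_laplacian 2
  have hDψ2 : ∀ σ, MemLp (Dψ σ) 2 volume := fun σ =>
    ((memLp_heatFlow_of_memLp hΔφ2 one_le_two _).const_smul ν).neg
  have hPL : ∀ s ∈ Icc 0 T, ∀ σ₁ σ₂, σ₁ ≤ σ₂ → σ₂ ≤ t →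
      (∫ x, ⟪u s x, ψ σ₂ x⟫) - ∫ x, ⟪u s x, ψ σ₁ x⟫ = ∫ σ in Ioc σ₁ σ₂, g s σ := by
    intro s hs σ₁ σ₂ h12 h2t
    rw [← intervalIntegral.integral_of_le h12]
    exact integral_inner_heatTest_sub_eq (hL2 s hs) hφ2 hφ.hasCompactSupport hν h12 h2t
  set Kg : ℝ≥0∞ := ENNReal.ofReal ν * (M * eLpNorm (Δ φ) 2 volume) with hKg
  have hKgtop : Kg ≠ ⊤ :=
    ENNReal.mul_ne_top ENNReal.ofReal_ne_top (ENNReal.mul_ne_top hMtop hΔφ2.eLpNorm_ne_top)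
  have hgb : ∀ s ∈ Icc 0 T, ∀ σ, ‖g s σ‖ ≤ Kg.toReal := by
    intro s hs σ
    refine norm_le_toReal_of_enorm_le hKgtop ?_
    refine (enorm_integral_inner_heatFlow_laplacian_le (hL2 s hs) hφ2 hφ.hasCompactSupport
      hν.le _).trans ?_
    rw [hKg]; gcongr; exact hM s hs
  -- measurability of `g s` (a parametric integral of a jointly measurable integrand)
  have hgm : ∀ s ∈ Icc 0 T, AEStronglyMeasurable (g s) volume := by
    intro s hs
    have hDc : Continuous fun q : ℝ × E => Dψ q.1 q.2 := continuous_heatTestDeriv hφ2 hφ.hasCompactSupport ν t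
    have hm : AEStronglyMeasurable (fun q : ℝ × E => ⟪u s q.2, Dψ q.1 q.2⟫)
        ((volume : Measure ℝ).prod (volume : Measure E)) :=
      AEStronglyMeasurable.inner (𝕜 := ℝ) (hL2 s hs).1.comp_snd hDc.aestronglyMeasurable
    exact hm.integral_prod_right'
  have hgi : ∀ s ∈ Icc 0 T, ∀ S : Set ℝ, volume S < ⊤ → IntegrableOn (g s) S := by
    intro s hs S hS
    haveI : IsFiniteMeasure (volume.restrict S) := ⟨by rwa [Measure.restrict_apply_univ]⟩
    exact Integrable.mono' (integrable_const Kg.toReal) (hgm s hs).restrict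
      (ae_of_all _ fun σ => hgb s hs σ)
  -- ### the uniform partition and the cell functions
  set sp : ℕ → ℕ → ℝ := fun n k => t * k / n with hsp
  set H : ℕ → ℕ → ℝ → ℝ := fun n k τ => B (sp n k) τ + g (sp n (k + 1)) τ with hH
  set Hn : ℕ → ℝ → ℝ := fun n τ =>
    ∑ k ∈ Finset.range n, (Ioc (sp n k) (sp n (k + 1))).indicator (H n k) τ with hHn
  have hsp0 : ∀ n, sp n 0 = 0 := fun n => by simp [hsp]
  have hspn : ∀ n, 0 < n → sp n n = t := fun n hn => by
    rw [hsp]; field_simp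
  have hsp_mono : ∀ n k, sp n k ≤ sp n (k + 1) := fun n k => by
    simp only [hsp]
    rcases Nat.eq_zero_or_pos n with h0 | hpos
    · simp [h0]
    · exact div_le_div_of_nonneg_right
        (mul_le_mul_of_nonneg_left (by exact_mod_cast Nat.le_succ k) ht0.le) (Nat.cast_pos.2 hpos).le
  have hsp_nonneg : ∀ n k, 0 ≤ sp n k := fun n k => by simp only [hsp]; positivity
  have hsp_le : ∀ n k, 0 < n → k ≤ n → sp n k ≤ t := fun n k hn hk => by
    simp only [hsp]
    rw [div_le_iff₀ (Nat.cast_pos.2 hn)]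
    exact mul_le_mul_of_nonneg_left (Nat.cast_le.2 hk) ht0.le
  have hsp_pos : ∀ n k, 0 < n → 0 < k → 0 < sp n k := fun n k hn hk => by
    simp only [hsp]; exact div_pos (mul_pos ht0 (Nat.cast_pos.2 hk)) (Nat.cast_pos.2 hn)
  have hsp_succ : ∀ n k, 0 < n → sp n (k + 1) = sp n k + t / n := fun n k hn => by
    simp only [hsp]; push_cast; ring
  -- ### the partition identity
  have hident : ∀ n, 0 < n → ∫ x, ⟪u t x, φ x⟫ =
      (∫ x, ⟪u₀ x, ψ 0 x⟫) + ∫ τ in Ioc 0 t, Hn n τ := by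
    intro n hn
    set p : ℕ → ℝ := fun k => if k = 0 then ∫ x, ⟪u₀ x, ψ 0 x⟫ else
      ∫ x, ⟪u (sp n k) x, ψ (sp n k) x⟫ with hp
    have hp0 : p 0 = ∫ x, ⟪u₀ x, ψ 0 x⟫ := by simp [hp]
    have hpn : p n = ∫ x, ⟪u t x, φ x⟫ := by
      simp only [hp, if_neg hn.ne', hspn n hn, hψ, sub_self, heatTest_zero_right]
    -- one cell
    have hcell : ∀ k, k < n → p (k + 1) - p k = ∫ τ in Ioc (sp n k) (sp n (k + 1)), H n k τ := by
      intro k hk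
      have hk1 : sp n (k + 1) ∈ Ioc 0 T :=
        ⟨hsp_pos n (k + 1) hn k.succ_pos, (hsp_le n (k + 1) hn hk).trans htT⟩
      have hk1' : sp n (k + 1) ∈ Icc 0 T := Ioc_subset_Icc_self hk1
      -- step A: moving the test field
      have hA : (∫ x, ⟪u (sp n (k + 1)) x, ψ (sp n (k + 1)) x⟫) -
          ∫ x, ⟪u (sp n (k + 1)) x, ψ (sp n k) x⟫ =
            ∫ σ in Ioc (sp n k) (sp n (k + 1)), g (sp n (k + 1)) σ :=
        hPL _ hk1' _ _ (hsp_mono n k) (hsp_le n (k + 1) hn hk)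
      -- step B: moving the velocity
      have hB' : (∫ x, ⟪u (sp n (k + 1)) x, ψ (sp n k) x⟫) - p k =
          ∫ τ in Ioc (sp n k) (sp n (k + 1)), B (sp n k) τ := by
        rcases Nat.eq_zero_or_pos k with hk0 | hkpos
        · subst hk0
          rw [hp0, hsp0, hstar 0 _ hk1]
          ring
        · have hkT : sp n k ∈ Ioc 0 T :=
            ⟨hsp_pos n k hn hkpos, (hsp_le n k hn hk.le).trans htT⟩
          have hpk : p k = ∫ x, ⟪u (sp n k) x, ψ (sp n k) x⟫ := by simp [hp, hkpos.ne']
          rw [hpk, hstar (sp n k) _ hk1, hstar (sp n k) _ hkT]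
          have hunion : Ioc 0 (sp n (k + 1)) = Ioc 0 (sp n k) ∪ Ioc (sp n k) (sp n (k + 1)) :=
            (Ioc_union_Ioc_eq_Ioc (hsp_nonneg n k) (hsp_mono n k)).symm
          have hdisj : Disjoint (Ioc 0 (sp n k)) (Ioc (sp n k) (sp n (k + 1))) :=
            Ioc_disjoint_Ioc_of_le le_rfl
          rw [hunion, setIntegral_union hdisj measurableSet_Ioc
            ((hBint _).mono_set (Ioc_subset_Ioc_right hkT.2))
            ((hBint _).mono_set (Ioc_subset_Ioc hkT.1.le hk1.2))]
          ring
      -- step C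
      have hp1 : p (k + 1) = ∫ x, ⟪u (sp n (k + 1)) x, ψ (sp n (k + 1)) x⟫ := by
        simp [hp]
      have hgi' : IntegrableOn (g (sp n (k + 1))) (Ioc (sp n k) (sp n (k + 1))) :=
        hgi _ hk1' _ (by rw [Real.volume_Ioc]; exact ENNReal.ofReal_lt_top)
      have hBi' : IntegrableOn (B (sp n k)) (Ioc (sp n k) (sp n (k + 1))) :=
        (hBint _).mono_set (Ioc_subset_Ioc (hsp_nonneg n k) hk1.2)
      calc p (k + 1) - p k = ((∫ x, ⟪u (sp n (k + 1)) x, ψ (sp n (k + 1)) x⟫) -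
            ∫ x, ⟪u (sp n (k + 1)) x, ψ (sp n k) x⟫) +
            ((∫ x, ⟪u (sp n (k + 1)) x, ψ (sp n k) x⟫) - p k) := by rw [hp1]; ring
        _ = (∫ σ in Ioc (sp n k) (sp n (k + 1)), g (sp n (k + 1)) σ) +
            ∫ τ in Ioc (sp n k) (sp n (k + 1)), B (sp n k) τ := by rw [hA, hB']
        _ = ∫ τ in Ioc (sp n k) (sp n (k + 1)), H n k τ := by
            rw [← integral_add hgi' hBi']
            exact integral_congr_ae (ae_of_all _ fun τ => by simp only [hH]; ring)
    -- summing the cells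
    have hsum : ∑ k ∈ Finset.range n, (p (k + 1) - p k) = p n - p 0 := Finset.sum_range_sub p n
    have hsum' : ∑ k ∈ Finset.range n, (p (k + 1) - p k) = ∫ τ in Ioc 0 t, Hn n τ := by
      rw [hHn]
      have hint : ∀ k ∈ Finset.range n, Integrable
          ((Ioc (sp n k) (sp n (k + 1))).indicator (H n k)) (volume.restrict (Ioc 0 t)) := by
        intro k hk
        have hk' := Finset.mem_range.1 hk
        have hk1' : sp n (k + 1) ∈ Icc 0 T :=
          ⟨hsp_nonneg n _, (hsp_le n (k + 1) hn hk').trans htT⟩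
        refine IntegrableOn.integrable_indicator ?_ measurableSet_Ioc
        refine IntegrableOn.restrict ?_
        refine (IntegrableOn.add ((hBint _).mono_set (Ioc_subset_Ioc (hsp_nonneg n k)
          ((hsp_le n (k + 1) hn hk').trans htT))) (hgi _ hk1' _ ?_))
        rw [Real.volume_Ioc]; exact ENNReal.ofReal_lt_top
      rw [integral_finsetSum _ hint]
      refine Finset.sum_congr rfl fun k hk => ?_
      have hk' := Finset.mem_range.1 hk
      rw [hcell k hk', setIntegral_indicator measurableSet_Ioc,
        inter_eq_right.2 (Ioc_subset_Ioc (hsp_nonneg n k) (hsp_le n (k + 1) hn hk'))]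
    rw [← hpn, ← hp0, ← hsum', hsum]
    ring
  -- ### good times: finite dissipation, `L⁴` slices, finite weight
  set W : ℝ → ℝ≥0∞ := fun τ => eLpNorm (u τ) 4 volume ^ (2 : ℝ) + ENNReal.ofReal |ν| *
    ∑ i, eLpNorm (fun x => Gu τ x (b i)) 2 volume with hW
  have hIW : ∫⁻ τ in Ioo 0 T, W τ < ⊤ := hu.lintegral_weight_lt_top hE3 hGum hGu hGu₂
  have hWm : AEMeasurable W (volume.restrict (Ioo 0 T)) := by
    refine ((FunctionSpaces.aemeasurable_eLpNorm_slice hu.aestronglyMeasurable_uncurry 4).pow_const _).add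
      (AEMeasurable.const_mul (Finset.aemeasurable_fun_sum _ fun i _ => ?_) _)
    exact (FunctionSpaces.measurable_eLpNorm_slice (g := fun s x => Gu s x (b i))
      ((ContinuousLinearMap.apply ℝ E (b i)).continuous.comp_stronglyMeasurable hGum) 2).aemeasurable
  set Dd : ℝ → ℝ≥0∞ := fun τ => ∫⁻ x, ENNReal.ofReal (frobeniusNormSq (Gu τ x)) with hDd
  have hDdm : Measurable Dd := measurable_lintegral_frobeniusNormSq hGum
  have hDfin : ∀ᵐ τ ∂(volume.restrict (Ioo 0 T)), Dd τ < ⊤ := ae_lt_top hDdm hGu₂.ne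
  have hWfin : ∀ᵐ τ ∂(volume.restrict (Ioo 0 T)), W τ < ⊤ := ae_lt_top' hWm hIW.ne
  have h4fin : ∀ᵐ τ ∂(volume.restrict (Ioo 0 T)), eLpNorm (u τ) 4 volume < ⊤ := by
    filter_upwards [hWfin] with τ hτ
    have : eLpNorm (u τ) 4 volume ^ (2 : ℝ) < ⊤ := lt_of_le_of_lt le_self_add hτ
    exact (ENNReal.rpow_lt_top_iff_of_pos zero_lt_two).1 this
  -- the same facts a.e. on `(0, t)`
  set μt : Measure ℝ := volume.restrict (Ioo 0 t) with hμt
  have hsubT : Ioo 0 t ⊆ Ioo 0 T := Ioo_subset_Ioo le_rfl htT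
  have hμle : μt ≤ volume.restrict (Ioo 0 T) := Measure.restrict_mono hsubT le_rfl
  have hGu' : ∀ᵐ τ ∂μt, HasWeakGradient (u τ) (Gu τ) := ae_mono hμle hGu
  have hDfin' : ∀ᵐ τ ∂μt, Dd τ < ⊤ := ae_mono hμle hDfin
  have hWfin' : ∀ᵐ τ ∂μt, W τ < ⊤ := ae_mono hμle hWfin
  have h4fin' : ∀ᵐ τ ∂μt, eLpNorm (u τ) 4 volume < ⊤ := ae_mono hμle h4fin
  have hmemt : ∀ᵐ τ ∂μt, τ ∈ Ioo 0 t := ae_restrict_mem measurableSet_Ioo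
  -- ### uniform Frobenius `L²` bound of `∇ψ(σ)` and the modulus of continuity
  set CF : ℝ≥0∞ := ∑ i, eLpNorm (fun y => fderiv ℝ φ y (b i)) 2 volume ^ 2 with hCF
  have hCFtop : CF ≠ ⊤ := by
    refine (ENNReal.sum_lt_top.2 fun i _ => ENNReal.pow_lt_top ?_).ne
    exact ((hφ.fderiv_apply_const (b i)).memLp_volume 2).eLpNorm_lt_top
  have hGψle : ∀ σ, ∫⁻ x, ENNReal.ofReal (frobeniusNormSq (Gψ σ x)) ≤ CF := by
    intro σ
    rw [lintegral_ofReal_frobeniusNormSq_eq_sum (hGψm σ), hCF]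
    refine Finset.sum_le_sum fun i _ => ?_
    have heq : (fun x => Gψ σ x (b i)) = heatTest ν (fun y => fderiv ℝ φ y (b i)) (t - σ) :=
      funext fun x => fderiv_heatTest_apply hφ ν _ x (b i)
    have h1 : ∫⁻ x, ‖Gψ σ x (b i)‖ₑ ^ (2 : ℝ) = eLpNorm (fun x => Gψ σ x (b i)) 2 volume ^ 2 := by
      rw [eLpNorm_two_sq_eq_lintegral]
      exact lintegral_congr fun x => by rw [ENNReal.rpow_two]
    rw [h1, heq]
    gcongr
    exact eLpNorm_heatFlow_le_of_memLp ((hφ.fderiv_apply_const (b i)).memLp_volume 2)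
      one_le_two _
  set CΔ : ℝ≥0∞ := ∑ i, (ENNReal.ofReal ν *
    eLpNorm (Δ (fun y => fderiv ℝ φ y (b i))) 2 volume) ^ 2 with hCΔ
  have hCΔtop : CΔ ≠ ⊤ := by
    refine (ENNReal.sum_lt_top.2 fun i _ => ENNReal.pow_lt_top (ENNReal.mul_lt_top
      ENNReal.ofReal_lt_top ?_)).ne
    exact ((hφ.fderiv_apply_const (b i)).memLp_laplacian 2).eLpNorm_lt_top
  have hGψsub : ∀ σ τ, σ ≤ τ → τ ≤ t →
      ∫⁻ x, ENNReal.ofReal (frobeniusNormSq (Gψ σ x - Gψ τ x)) ≤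
        ENNReal.ofReal (τ - σ) ^ 2 * CΔ := by
    intro σ τ hστ hτt
    have h := lintegral_frobeniusNormSq_fderiv_heatTest_sub_le hφ hν hστ hτt
    refine le_trans (le_of_eq (lintegral_congr fun x => ?_)) h
    rw [frobeniusNormSq_sub_comm]
  -- ### the flux bounds at good times
  have hBbound : ∀ τ, HasWeakGradient (u τ) (Gu τ) → Dd τ < ⊤ → eLpNorm (u τ) 4 volume < ⊤ →
      τ ∈ Ioo 0 T → ∀ σ, ‖B σ τ‖ₑ ≤ CF ^ (1 / 2 : ℝ) * W τ := by
    intro τ hGτ hDτ h4τ hτ σ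
    have hmem4 : MemLp (u τ) 4 volume := ⟨(hL2 τ (Ioo_subset_Icc_self hτ)).1, h4τ⟩
    have hGi : ∀ i, MemLp (fun x => Gu τ x (b i)) 2 volume := fun i => hGτ.memLp_apply hDτ i
    have h := enorm_weakFlux_sub_le hmem4 hGτ.aestronglyMeasurable_deriv hGi (hGψm σ)
      (aestronglyMeasurable_const (b := (0 : E →L[ℝ] E))) (hGψ2 σ) (by simp) ν
    simp only [_root_.zero_apply, inner_zero_left, inner_zero_right,
      integral_zero, Finset.sum_const_zero, mul_zero, sub_zero] at h
    refine h.trans ?_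
    gcongr
    exact hGψle σ
  have hBsub : ∀ τ, HasWeakGradient (u τ) (Gu τ) → Dd τ < ⊤ → eLpNorm (u τ) 4 volume < ⊤ →
      τ ∈ Ioo 0 t → ∀ σ, σ ≤ τ →
        ‖B σ τ - B τ τ‖ₑ ≤ (ENNReal.ofReal (τ - σ) ^ 2 * CΔ) ^ (1 / 2 : ℝ) * W τ := by
    intro τ hGτ hDτ h4τ hτ σ hστ
    have hmem4 : MemLp (u τ) 4 volume := ⟨(hL2 τ (Ioo_subset_Icc_self (hsubT hτ))).1, h4τ⟩
    have hGi : ∀ i, MemLp (fun x => Gu τ x (b i)) 2 volume := fun i => hGτ.memLp_apply hDτ i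
    have h := enorm_weakFlux_sub_le hmem4 hGτ.aestronglyMeasurable_deriv hGi (hGψm σ) (hGψm τ)
      (hGψ2 σ) (hGψ2 τ) ν
    refine h.trans ?_
    gcongr
    exact hGψsub σ τ hστ hτ.2.le
  -- ### dominated convergence on `(0, t)`
  have hWm' : AEMeasurable W μt := hWm.mono_measure hμle
  set bound : ℝ → ℝ := fun τ => (CF ^ (1 / 2 : ℝ) * W τ).toReal + Kg.toReal with hbound
  have hbound_int : Integrable bound μt := by
    refine Integrable.add ?_ (integrable_const _)
    refine integrable_toReal_of_lintegral_ne_top (hWm'.const_mul _) ?_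
    have hCF2 : CF ^ (1 / 2 : ℝ) ≠ ⊤ := ENNReal.rpow_ne_top_of_nonneg (by norm_num) hCFtop
    rw [lintegral_const_mul'' _ hWm']
    refine ENNReal.mul_ne_top hCF2 (lt_of_le_of_lt (lintegral_mono' hμle le_rfl) hIW).ne
  -- measurability of the cell functions
  have hBm : ∀ σ, AEStronglyMeasurable (B σ) μt := fun σ =>
    (aestronglyMeasurable_weakFlux (hGψm σ) hu.aestronglyMeasurable_uncurry hGum ν).mono_measure hμle
  have hHnm : ∀ n, 0 < n → AEStronglyMeasurable (Hn n) μt := by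
    intro n hn
    refine Finset.aestronglyMeasurable_fun_sum (Finset.range n) fun k hk => ?_
    have hk' := Finset.mem_range.1 hk
    have hk1' : sp n (k + 1) ∈ Icc 0 T := ⟨hsp_nonneg n _, (hsp_le n (k + 1) hn hk').trans htT⟩
    exact ((hBm _).add ((hgm _ hk1').restrict)).indicator measurableSet_Ioc
  -- pointwise bound
  have hHn_le : ∀ n, ∀ᵐ τ ∂μt, ‖Hn (n + 1) τ‖ ≤ bound τ := by
    intro n
    filter_upwards [hGu', hDfin', h4fin', hWfin', hmemt] with τ hGτ hDτ h4τ hWτ hτ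
    obtain ⟨k, hk, hτk⟩ := exists_mem_Ioc_partition ht0 (Nat.succ_pos n) ⟨hτ.1, hτ.2.le⟩
    have heval : Hn (n + 1) τ = H (n + 1) k τ :=
      sum_indicator_partition_eq ht0 (Nat.succ_pos n) (H (n + 1)) hk hτk
    rw [heval]
    have hk1' : sp (n + 1) (k + 1) ∈ Icc 0 T :=
      ⟨hsp_nonneg _ _, (hsp_le (n + 1) (k + 1) (Nat.succ_pos n) hk).trans htT⟩
    have hCW : CF ^ (1 / 2 : ℝ) * W τ ≠ ⊤ :=
      ENNReal.mul_ne_top (ENNReal.rpow_ne_top_of_nonneg (by norm_num) hCFtop) hWτ.ne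
    calc ‖H (n + 1) k τ‖ ≤ ‖B (sp (n + 1) k) τ‖ + ‖g (sp (n + 1) (k + 1)) τ‖ := norm_add_le _ _
      _ ≤ (CF ^ (1 / 2 : ℝ) * W τ).toReal + Kg.toReal :=
          add_le_add (norm_le_toReal_of_enorm_le hCW (hBbound τ hGτ hDτ h4τ (hsubT hτ) _))
            (hgb _ hk1' _)
  -- pointwise convergence
  have hHn_lim : ∀ᵐ τ ∂μt, Tendsto (fun n => Hn (n + 1) τ) atTop (𝓝 (B τ τ + g τ τ)) := by
    filter_upwards [hGu', hDfin', h4fin', hWfin', hmemt] with τ hGτ hDτ h4τ hWτ hτ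
    have hex : ∀ n : ℕ, ∃ k, k < n + 1 ∧ τ ∈ Ioc (sp (n + 1) k) (sp (n + 1) (k + 1)) := fun n =>
      exists_mem_Ioc_partition ht0 (Nat.succ_pos n) ⟨hτ.1, hτ.2.le⟩
    choose kn hkn hτkn using hex
    have heval : ∀ n, Hn (n + 1) τ = B (sp (n + 1) (kn n)) τ + g (sp (n + 1) (kn n + 1)) τ :=
      fun n => sum_indicator_partition_eq ht0 (Nat.succ_pos n) (H (n + 1)) (hkn n) (hτkn n)
    -- the mesh
    have hmesh : ∀ n, sp (n + 1) (kn n + 1) = sp (n + 1) (kn n) + t / ((n : ℝ) + 1) := by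
      intro n
      rw [hsp_succ (n + 1) (kn n) (Nat.succ_pos n)]
      push_cast; ring
    have hmesh0 : Tendsto (fun n : ℕ => t / ((n : ℝ) + 1)) atTop (𝓝 0) := by
      have := tendsto_one_div_add_atTop_nhds_zero_nat.const_mul t
      rw [mul_zero] at this
      exact this.congr fun n => by ring
    have hσle : ∀ n, sp (n + 1) (kn n) ≤ τ := fun n => (hτkn n).1.le
    have hσge : ∀ n : ℕ, τ - t / ((n : ℝ) + 1) ≤ sp (n + 1) (kn n) := fun n => by
      have := (hτkn n).2; rw [hmesh n] at this; linarith
    -- (i) the flux term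
    have hBlim : Tendsto (fun n => B (sp (n + 1) (kn n)) τ) atTop (𝓝 (B τ τ)) := by
      refine tendsto_of_enorm_sub_le
        (e := fun n => (ENNReal.ofReal (t / ((n : ℝ) + 1)) ^ 2 * CΔ) ^ (1 / 2 : ℝ) * W τ)
        (fun n => ?_) ?_
      · refine (hBsub τ hGτ hDτ h4τ hτ _ (hσle n)).trans ?_
        gcongr
        linarith [hσge n]
      · have h1 : Tendsto (fun n : ℕ => ENNReal.ofReal (t / ((n : ℝ) + 1))) atTop (𝓝 0) := by
          have := ENNReal.tendsto_ofReal hmesh0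
          rwa [ENNReal.ofReal_zero] at this
        have h2 : Tendsto (fun n : ℕ => ENNReal.ofReal (t / ((n : ℝ) + 1)) ^ 2 * CΔ) atTop (𝓝 0) := by
          have := ENNReal.Tendsto.mul_const ((ENNReal.Tendsto.pow (n := 2) h1)) (Or.inr hCΔtop)
          simpa using this
        have h3 : Tendsto (fun n : ℕ => (ENNReal.ofReal (t / ((n : ℝ) + 1)) ^ 2 * CΔ) ^ (1 / 2 : ℝ))
            atTop (𝓝 0) := by
          have := h2.ennrpow_const (1 / 2 : ℝ)
          rwa [ENNReal.zero_rpow_of_pos (by norm_num)] at this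
        have h4 := ENNReal.Tendsto.mul_const h3 (Or.inr hWτ.ne)
        rwa [zero_mul] at h4
    -- (ii) the pairing term: weak continuity of `u` at `τ`
    have hglim : Tendsto (fun n => g (sp (n + 1) (kn n + 1)) τ) atTop (𝓝 (g τ τ)) := by
      have hτT : τ ∈ Ioc 0 T := ⟨hτ.1, hτ.2.le.trans htT⟩
      have hwc := ((hu.weak_continuous (Dψ τ) (hDψ2 τ)).1 τ hτT).tendsto
      have hs : Tendsto (fun n => sp (n + 1) (kn n + 1)) atTop (𝓝[Ioc 0 T] τ) := by
        refine tendsto_nhdsWithin_iff.2 ⟨?_, Eventually.of_forall fun n => ?_⟩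
        · refine tendsto_of_tendsto_of_tendsto_of_le_of_le tendsto_const_nhds
            (?_ : Tendsto (fun n : ℕ => τ + t / ((n : ℝ) + 1)) atTop (𝓝 τ)) (fun n => (hτkn n).2)
            (fun n => by rw [hmesh n]; linarith [hσle n])
          have := hmesh0.const_add τ
          rwa [add_zero] at this
        · exact ⟨hτ.1.trans_le (hτkn n).2,
            (hsp_le (n + 1) (kn n + 1) (Nat.succ_pos n) (hkn n)).trans htT⟩
      exact hwc.comp hs
    exact (hBlim.add hglim).congr fun n => (heval n).symm
  have hDCT := tendsto_integral_of_dominated_convergence bound (fun n => hHnm (n + 1) (Nat.succ_pos n))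
    hbound_int hHn_le hHn_lim
  -- ### the sequence of integrals is constant
  have hconst : ∀ n, ∫ τ, Hn (n + 1) τ ∂μt = (∫ x, ⟪u t x, φ x⟫) - ∫ x, ⟪u₀ x, ψ 0 x⟫ := by
    intro n
    rw [hμt, ← integral_Ioc_eq_integral_Ioo, hident (n + 1) (Nat.succ_pos n)]
    ring
  have hlimval : (∫ x, ⟪u t x, φ x⟫) - ∫ x, ⟪u₀ x, ψ 0 x⟫ = ∫ τ, (B τ τ + g τ τ) ∂μt := by
    have h1 : Tendsto (fun _ : ℕ => (∫ x, ⟪u t x, φ x⟫) - ∫ x, ⟪u₀ x, ψ 0 x⟫) atTop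
        (𝓝 (∫ τ, (B τ τ + g τ τ) ∂μt)) := hDCT.congr hconst
    exact tendsto_nhds_unique tendsto_const_nhds h1
  -- ### identification of the limit integrand: the viscous terms cancel
  have hid : ∀ᵐ τ ∂μt, B τ τ + g τ τ = ∫ x, ⟪u τ x, convect (u τ) (ψ τ) x⟫ := by
    filter_upwards [hGu', hDfin', hmemt] with τ hGτ hDτ hτ
    have hτT : τ ∈ Icc 0 T := ⟨hτ.1.le, hτ.2.le.trans htT⟩
    have hGi : ∀ i, MemLp (fun x => Gu τ x (b i)) 2 volume := fun i => hGτ.memLp_apply hDτ i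
    have hibp := hGτ.integral_inner_laplacian_of_memLp (hL2 τ hτT) hGi
      (contDiff_heatTest hφ ν (t - τ)) (fun i => memLp_fderiv_heatTest_apply hφ ν _ (b i))
      (fun i => memLp_fderiv_fderiv_heatTest_apply hφ ν _ (b i))
    have hDψeq : ∀ x, Dψ τ x = -(ν • (Δ (ψ τ)) x) := fun x => by
      simp only [hDψ, hψ, laplacian_heatTest hφ]
      rfl
    have hgval : g τ τ = ν * ∑ i, ∫ x, ⟪Gu τ x (b i), Gψ τ x (b i)⟫ := by
      simp only [hg]
      have h1 : (fun x => ⟪u τ x, Dψ τ x⟫) = fun x => -ν * ⟪u τ x, (Δ (ψ τ)) x⟫ := by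
        ext x; rw [hDψeq x, inner_neg_right, real_inner_smul_right]; ring
      rw [h1, integral_const_mul, hibp]
      ring
    have hBval : B τ τ = (∫ x, ⟪Gψ τ x (u τ x), u τ x⟫) -
        ν * ∑ i, ∫ x, ⟪Gu τ x (b i), Gψ τ x (b i)⟫ := rfl
    rw [hBval, hgval, sub_add_cancel]
    refine integral_congr_ae (ae_of_all _ fun x => ?_)
    show ⟪Gψ τ x (u τ x), u τ x⟫ = ⟪u τ x, convect (u τ) (ψ τ) x⟫
    rw [convect_apply]
    exact real_inner_comm _ _
  -- ### conclusion
  have hfin : ∫ τ, (B τ τ + g τ τ) ∂μt =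
      ∫ τ in Ioc 0 t, ∫ x, ⟪u τ x, convect (u τ) (heatTest ν φ (t - τ)) x⟫ := by
    rw [integral_congr_ae hid, hμt, integral_Ioc_eq_integral_Ioo]
  have hψ0 : ψ 0 = heatTest ν φ t := by simp only [hψ, sub_zero]
  rw [hfin, hψ0] at hlimval
  linarith

/-- A left limit at `t` of a function known a.e. on `(0, T)`: if `f → L` as `s → t⁻`,
`0 < t ≤ T`, and `f s = c` for a.e. `s ∈ (0, T)`, then `L = c`. [folklore] -/
theorem eq_of_tendsto_nhdsLT_of_ae_eq {β : Type*} [TopologicalSpace β] [T2Space β] {t : ℝ}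
    (ht : 0 < t) (htT : t ≤ T) {f : ℝ → β} {L c : β} (hf : Tendsto f (𝓝[<] t) (𝓝 L))
    (hae : ∀ᵐ s ∂(volume.restrict (Ioo 0 T)), f s = c) : L = c := by
  refine tendsto_nhds_unique_of_frequently_eq hf tendsto_const_nhds ?_
  rw [Filter.frequently_iff]
  intro U hU
  obtain ⟨a, hat, haU⟩ := mem_nhdsLT_iff_exists_Ioo_subset.1 hU
  set a' : ℝ := max a 0 with ha'
  have ha't : a' < t := max_lt hat ht
  have hsub : Ioo a' t ⊆ Ioo 0 T := Ioo_subset_Ioo (le_max_right _ _) htT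
  have hae' : ∀ᵐ s ∂(volume.restrict (Ioo a' t)), f s = c :=
    ae_mono (Measure.restrict_mono hsub le_rfl) hae
  by_contra hne
  push Not at hne
  have hfalse : ∀ᵐ s ∂(volume.restrict (Ioo a' t)), False := by
    filter_upwards [hae', ae_restrict_mem measurableSet_Ioo] with s hs hs'
    exact hne s (haU ⟨(le_max_left _ _).trans_lt hs'.1, hs'.2⟩) hs
  rw [eventually_false_iff_eq_bot, ae_eq_bot, Measure.restrict_eq_zero, Real.volume_Ioo,
    ENNReal.ofReal_eq_zero] at hfalse
  linarith

/-- **Every positive-time slice of a Leray–Hopf solution is weakly divergence free.** The slices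
are weakly divergence free for a.e. time (weak formulation), and `s ↦ ∫⟪u s, ∇θ⟫` is continuous on
`(0, T]` (weak `L²`-continuity with the test field `∇θ ∈ L²`), so it vanishes at every
`t ∈ (0, T]` (Galdi 2000, Lemma 2.2 and Def. 2.1). [folklore] -/
theorem IsLerayHopfOn.isWeaklyDivFree_slice {f : ℝ → E → E} (h : IsLerayHopfOn T ν f u₀ u)
    {t : ℝ} (ht : t ∈ Ioc 0 T) : IsWeaklyDivFree (u t) := by
  intro θ hθ
  have hgc : Continuous (gradient θ) :=
    (InnerProductSpace.toDual ℝ E).symm.continuous.comp (hθ.contDiff.continuous_fderiv (by simp))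
  have hgs : HasCompactSupport (gradient θ) :=
    (hθ.hasCompactSupport.fderiv (𝕜 := ℝ)).comp_left (g := (InnerProductSpace.toDual ℝ E).symm)
      (map_zero _)
  have hw : MemLp (gradient θ) 2 volume := hgc.memLp_of_hasCompactSupport hgs
  have hcont : ContinuousOn (fun s => ∫ x, ⟪u s x, gradient θ x⟫) (Ioc 0 T) :=
    (h.weak_continuous _ hw).1
  have hae : ∀ᵐ s ∂(volume.restrict (Ioo 0 T)), (∫ x, ⟪u s x, gradient θ x⟫) = 0 :=
    h.weak.ae_isWeaklyDivFree.mono fun s hs => hs θ hθ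
  have hmem : Ioc 0 T ∈ 𝓝[<] t :=
    mem_nhdsWithin.2 ⟨Ioi 0, isOpen_Ioi, ht.1, fun s hs => ⟨hs.1, (le_of_lt hs.2).trans ht.2⟩⟩
  have hlim : Tendsto (fun s => ∫ x, ⟪u s x, gradient θ x⟫) (𝓝[<] t)
      (𝓝 (∫ x, ⟪u t x, gradient θ x⟫)) :=
    (hcont t ht).tendsto.mono_left (nhdsWithin_le_of_mem hmem)
  exact eq_of_tendsto_nhdsLT_of_ae_eq ht.1 ht.2 hlim hae

/-- **Leray–Hopf weak solutions are mild solutions on `(0, T]`** (Fabes–Jones–Rivière 1972,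
Thm. 2.1, (i) ⇒ (ii); Lemarié-Rieusset 2016, Prop. 6.5 + Thm. 6.1, (A) ⇒ (B), for Leray's weak
solutions). Let `dim E = 3`, `0 < ν`, `0 < T`, `u₀ ∈ L²`, and let `u` be a Leray–Hopf weak solution
of the unforced Navier–Stokes system on `E × [0, T)` with datum `u₀`. Then `u` is a mild solution
on `(0, T]` with datum `u₀` in the accepted duality form `Fluid.IsMildNSSolutionOn`: every slice
`u(t)`, `0 < t ≤ T`, is weakly divergence free and
`⟨u(t), φ⟩ = ⟨u₀, e^{νtΔ}φ⟩ + ∫₀ᵗ ⟨u, (u·∇)e^{ν(t-τ)Δ}φ⟩ dτ` for every smooth compactly supported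
divergence-free `φ`. (The slice `u 0` of the accepted Leray–Hopf predicate is unconstrained,
whence `(0, T]`.) [cite: FabesJonesRiviere1972, Thm. 2.1] -/
theorem IsLerayHopfOn.isMildNSSolutionOn_Ioc (hE3 : Module.finrank ℝ E = 3)
    (hu : IsLerayHopfOn T ν 0 u₀ u) (hu₀ : MemLp u₀ 2 volume) (hν : 0 < ν) (hT : 0 < T) :
    IsMildNSSolutionOn (Ioc 0 T) ν 0 u₀ u := by
  refine ⟨fun t ht => hu.isWeaklyDivFree_slice ht, fun t ht φ hφ hdiv => ?_⟩
  rw [intervalIntegral.integral_of_le ht.1.le, intervalIntegral.integral_of_le ht.1.le,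
    hu.integral_inner_eq_mild hE3 hu₀ hν hT hφ hdiv ht]
  simp

end Main

end Literature.Analysis.FluidPDE

end
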